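import Mathlib
import Summits.AnomalousDissipation.AnomalousDissipation.Theses.WazewskiBlock
import Literature.Analysis.FluidPDE.GalerkinFlow
import Summits.AnomalousDissipation.AnomalousDissipation.Theorems.WazewskiBlockUniformGalerkinTrapLineSketchIdeator4
import Summits.AnomalousDissipation.AnomalousDissipation.Theorems.WazewskiBlockUniformGalerkinTrapStubMeanZeroInvariant
import HarnessLib

/-!
# Skeleton of line `TailLift` — crux stmt-AnomalousDissipation-10352 (`WazewskiBlock.UniformGalerkinTrap`), crux-strategist r1.
# PART I: piece P2 proved (ns `…TailLift.P2`); §STUBS: `stub_robustLoudLowBlocks` (P1, THE BET — the only `sorry`) and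
# `stub_uniformTailEstimates` (P2 := PART I); PART II: the tail-lift assembly lemmas ending in the composition
# `UniformGalerkinTrap_of : Theses.WazewskiBlock.UniformGalerkinTrap` from the two registered stubs (the ONLY theorem concluding
# the crux in this file).  The landable sorry-free file is `Lines/TailLiftSplit.lean` (assembly `P1 → P2 → X`, `P1 → X`).

Sorry-free; axioms `propext`, `Classical.choice`, `Quot.sound`.  Three parts, each in its own namespace:

* PART I (`…TailEstimates`, ≈ 850 lines): the piece P2 `UniformTailEstimates` — the `N`-uniform self-consistent tail
  inequalities of the Gevrey profile — PROVED: `TailEstimates.stub_uniformTailEstimates` (verbatim the registered stub of line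
  `TailLift` / the route leaf-to-be).
* PART II (`…TailLiftSplit`, ≈ 650 lines): the ASSEMBLY `TailLiftSplit.uniformGalerkinTrap_of_tailLift : P1 → P2 → X` (the two
  pieces spelled out verbatim; `--glue-by` target of the prepared `route edit --split UniformGalerkinTrap`), and `faces_pos`.
* PART III (`…TailLiftSplit`): the REDUCED composition `uniformGalerkinTrap_of_robustLoudLowBlocks : P1 → X` = PART II
  applied to PART I — the crux now follows from the SINGLE open piece P1 `RobustLoudLowBlocks` (one ν-parametrised robust loud
  polyfacial block of the ORDER-m Galerkin system per viscosity, level `m` independent of any `N`, Gevrey-enclosed, mean mode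
  hardwired, faceless instance excluded), which is not the crux or the summit reworded (BC2 probes fail; `X ⇏ P1` in kind).

A prover landing this verbatim as `Theorems/WazewskiBlockUniformGalerkinTrapTailLiftSplit.lean` (`--supports
stmt-AnomalousDissipation-10352`) proves the registered stub `stub_uniformTailEstimates` by name + signature and provides the glue
decl for the split; only the two namespaces need `Cruxes` ↦ `Theorems`.

The module docstrings of the two parts follow.
-/

/-!
# Piece P2 `UniformTailEstimates` of the tail-lift split of crux stmt-AnomalousDissipation-10352
# (`WazewskiBlock.UniformGalerkinTrap`) — PROVED (crux-strategist r1, 2026-08-17)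

Sorry-free; axioms `propext`, `Classical.choice`, `Quot.sound`.  The final theorem `stub_uniformTailEstimates` has VERBATIM
the signature of the registered stub of line `TailLift` (= the second hypothesis of
`TailLiftSplit.uniformGalerkinTrap_of_tailLift`, = the route leaf-to-be `UniformTailEstimates`); a prover lands this file
under `Theorems/` with `--supports stmt-AnomalousDissipation-10352` (planners cannot write `Theorems/`).

## Statement (the `N`-uniform Zgliczyński–Mischaikow tail inequalities of the profile `â_k = A θ^{|k|₁}(1+|k|₁)^{-6}`)

∀ `ν A θ δ > 0`, `θ < 1`, ∃ `M` ∀ `M ≤ m ≤ N` ∀ `x : ↥(freqBall N) → ℂ³` with `‖x k‖ ≤ â_k`: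
(i) per-mode tail ENTRANCE — `m² < |k|²`, `g k = 0`, `‖x k‖ = â_k` ⟹ `Re⟪x k, (galerkinRHS ν g x) k⟫ < 0`;
(ii) modewise low/tail COUPLING — ∀ `f`, ∀ `k` of order `m`:
`‖(F_N x)_k − (F_m (x|_{≤m}))_k‖ ≤ ν A θ^{max(|k|₁,m)} (1+max(|k|₁,m))^{-4}`;
(iii)/(iv) tail energy/enstrophy — `½∑_{≤N}‖x k‖² ≤ ½∑_{≤m}‖x k‖² + δ`, `4π²∑_{≤N}|k|²‖x k‖² ≤ 4π²∑_{≤m}|k|²‖x k‖² + δ`.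

## Proof

* §1 `|k|₁ = ∑|kᵢ|` (`l1`): `|k|₂² ≤ |k|₁² ≤ 3|k|₂²`, subadditivity, `m² < |k|₂² ⇒ m+1 ≤ |k|₁`, `|k|₂² ≤ m² ⇒ |k|₁ ≤ 2m`,
  `|∑ cⱼ mⱼ| ≤ ‖c‖ |m|₁`.
* §2 THE LATTICE CONSTANT `C = latC = (∑_{n∈ℤ}(1+|n|)^{-2})³` (summable by comparison with `1/n²`): for EVERY finite
  `T ⊂ ℤ³`, `∑_{j∈T}(1+|j|₁)^{-6} ≤ C` (`latticeSum_le`) — via `(1+|j|₁)³ ≥ ∏ᵢ(1+|jᵢ|)` (expand the cube), a box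
  `T ⊆ [-R,R]³`, `Finset.prod_univ_sum` and `∑_{finite} ≤ ∑'`.  No shell counting, no fractional powers.
* §3 profile algebra (`prof(k−l')·|l'|₁·prof(l') ≤ A²θ^{|k|₁}(1+|k−l'|₁)^{-6}(1+|l'|₁)^{-5}`) and THE KEY WEIGHTED SUM
  `keySum_le`: `∑_{l'∈T, m ≤ |l'|₁}(1+|k−l'|₁)^{-6}(1+|l'|₁)^{-5} ≤ 96 C (1+max(|k|₁,m))^{-5}` (regions `2|l'|₁ ≥ |k|₁` /
  `<`; in the second `|k−l'|₁ > |k|₁/2` and one power of `(1+|l'|₁)` is spent against `(1+|k|₁)`).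
* §4 `‖B(c,c')_k‖ ≤ 2π∑_{l'}‖c(k−l')‖ |l'|₁ ‖c' l'‖` (the `l`-sum collapses on `l = k − l'`), hence inside the box
  `‖B(x,x)_k‖ ≤ 192 π C A (1+|k|₁) prof(k)`.
* §5 clause (i): `Re⟪x_k,(F x)_k⟫ = −4π²ν|k|₂²‖x_k‖² + Re⟪x_k, L_k(−B_k)⟫ ≤ prof²(192πCA(1+|k|₁) − 4π²ν|k|₂²) < 0` once
  `288 C A < π ν (m+1)` (`|k|₁ ≥ m+1`, `|k|₁² ≤ 3|k|₂²`).
* §6 clauses (iii)/(iv): split the sums at `|k| = m`; in the tail `prof(k)² ≤ A²θ^{2m}(1+|k|₁)^{-6}`,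
  `|k|₂² prof(k)² ≤ A²θ^{2m}(1+|k|₁)^{-6}`, so both tails are `≤ (·) A²θ^{2m} C`.
* §7 clause (ii): at `k` of order `m` the linear and force terms cancel, the difference is
  `L_k(B^m_k − B^N_k)`; `B^m = B_{freqBall N}(x𝟙_{≤m}, x𝟙_{≤m})`; bilinearity splits `B^N − B^m = B(z, x) + B(x𝟙_{≤m}, z)`
  with `z = x𝟙_{>m}`; each pair has its OUTSIDE member beyond `m` (`θ`-exponent `≥ max(|k|₁, m)`), the `|l'|₁` weight is
  paid by the outside member (`|l'|₁ ≤ 3(1+|k−l'|₁)` when `|k|₁ ≤ 2m`), and `keySum_le` (once reindexed by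
  `l' ↦ k − l'`) gives `‖·‖ ≤ 768 π C A² θ^ρ (1+ρ)^{-5} ≤ ν A θ^ρ (1+ρ)^{-4}` once `768 π C A ≤ ν (m+1)`.
* §8 `M = max M₀ (max M₁ M₂)` by Archimedes and `exists_pow_lt_of_lt_one`.

References: Zgliczyński–Mischaikow, FoCM 1 (2001) §3 (self-consistent a-priori bounds); Foias–Temam, JFA 87 (1989);
Robinson–Rodrigo–Sadowski 2016 Thm 4.4 (4.5); tree: `convectionCoeff_def`, `galerkinField_def`, `norm_leraySym_le`.
-/

/-!
# Crux `WazewskiBlock.UniformGalerkinTrap` (stmt-AnomalousDissipation-10352) — the TAIL-LIFT SPLIT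
# `RobustLoudLowBlocks → UniformTailEstimates → UniformGalerkinTrap`

Crux-strategist r1 (EXEMPT-46 re-exam fix, 2026-08-17).  Sorry-free; axioms `propext`, `Classical.choice`,
`Quot.sound`.  Written in the crux-workfile namespace `…Cruxes.UniformGalerkinTrap.TailLiftSplit`; a prover landing
it verbatim as `Theorems/WazewskiBlockUniformGalerkinTrapTailLiftSplit.lean` only renames the namespace to
`…Theorems.UniformGalerkinTrap.TailLiftSplit` (`--supports stmt-AnomalousDissipation-10352`).

## What is decomposed, and why along this seam

The crux `X = UniformGalerkinTrap` (∃ trig-poly mean-zero `f`, `E ε₀ ν₀`, ∀ `ν ≤ ν₀` ∃ `G N₀` ∀ `N ≥ N₀`: an order-`N`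
Galerkin orbit forever in `{KE ≤ E, (f,·) ≥ ε₀, ‖∇·‖² ≤ G}`) is `⇔ WindowInvariantSets` (p105977) and was binned RESTATED
(at least summit strength).  The re-exam of line `SketchIdeator4` (card `gevrey-tail-lift`) found its assembly
`TailLift.uniformGalerkinTrap_of_entranceFacedBlocks` (p119366) NON-TRIVIAL but its lone open stub PIECE-EQUIVALENT:
with zero faces and a free closed invariant set `M`, "entrance-faced block data at every level" contains `X` itself.
The fix asked for: exclude the degenerate instance and make the bet carry the mechanism `X` does not — a level-`m`
certificate with `m` independent of `N` plus an `N`-uniform tail-entrance inequality, with the tail-lift assembly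
PROVED between them.  This file is that assembly.  The two pieces (spelled out verbatim in the statement of
`uniformGalerkinTrap_of_tailLift`, and filed as the route's leaves `RobustLoudLowBlocks`, `UniformTailEstimates`):

* **P1 `RobustLoudLowBlocks` (crux, open — the ν → 0 content in constructive, finite-dimensional form).**  A mean-zero
  trig-poly force `f` (level `mf`), window constants `E ε₀ ν₀`, and for every `0 < ν ≤ ν₀` a Gevrey profile
  `â_k = A θ^{|k|₁} (1+|k|₁)^{-6}` (`A > 0`, `0 < θ < 1`), a slack `δ > 0` and a cap `G`, such that at levels `m ≥ mf`
  BEYOND EVERY BOUND (`∀ M ∃ m ≥ M`) there is a polyfacial block of the ORDER-`m` Galerkin system: finitely many `C¹`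
  faces `h i` on the coefficient space of order `m` (Fréchet derivatives `h' i`, continuous), block
  `B = {∀ i, h i ≥ 0} ∩ {mean mode = 0}`, with (a) ROBUST transversality — on an active face, `h' i y (F_m y + w) ≠ 0`
  for every modewise perturbation `‖w k‖ ≤ ν A θ^{max(|k|₁,m)} (1+max(|k|₁,m))^{-4}` of the order-`m` field `F_m`;
  (b) NO retraction of `B` onto its exit set `B⁻ = {y ∈ B | ∃ i, h i y = 0 ∧ h' i y (F_m y) < 0}`; (c) enclosure
  `B ⊆ {‖y k‖ ≤ â_k ∀ k} ∩ {½∑‖y k‖² + δ ≤ E} ∩ {∑ Re⟪f̂ k, y k⟫ ≥ ε₀} ∩ {4π²∑|k|²‖y k‖² + δ ≤ G}`.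
  It mentions no order `N > m`: it is ONE finite-dimensional robust certificate per viscosity (at unboundedly many
  levels), the Zgliczyński–Mischaikow object, with the closed invariant set HARDWIRED to the mean-zero vectors.
* **P2 `UniformTailEstimates` (support-class, load-bearing, provable now — the `N`-uniform self-consistent tail
  inequalities for the profile).**  For all `ν A θ δ > 0`, `θ < 1`, there is a sweeping scale `M` such that for
  `M ≤ m ≤ N` and every coefficient vector `x` of order `N` inside the profile box: (i) every tail mode `m² < |k|²` with
  no forcing on it and `‖x k‖ = â_k` is a strict ENTRANCE face, `Re⟪x k, (F_N x) k⟫ < 0` (dissipation `4π²ν|k|²â_k²`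
  beats the convolution `≤ 2πA C (1+|k|₁) â_k²`, `C = 96 C₆`, `C₆ = ∑_{j∈ℤ³}(1+|j|₁)^{-6} ≤ 27`, once
  `|k| > A C (1+√3)/(2πν)`); (ii) the modewise low/tail COUPLING `‖(F_N x)_k − (F_m (x|_{≤m}))_k‖`, `|k| ≤ m`, is
  below the majorant of P1 (true value `≤ K A² θ^{max(|k|₁,m)} (1+max)^{-5}`, `K ≤ 4π·96·27`, below the majorant once `m + 1 ≥ K A/ν`);
  (iii)/(iv) the tail energy and enstrophy of the box are `≤ δ` (`θ^{2m}`-small).  Profile exponent `6` (any `s ≥ 5`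
  works analytically — with `4` the `|l'|`-weighted convolution over `ℤ³` diverges like `log N`; `6` is chosen so that every
  lattice sum needed is dominated by `∑_{j∈ℤ³} ∏ᵢ (1+|jᵢ|)^{-2} ≤ 27` through `(1+|j|₁)³ ≥ ∏ᵢ(1+|jᵢ|)`, with no fractional
  powers); the majorant exponent `4 = s − 2` absorbs `K` into the threshold (`K A ≤ ν (1 + m)`) while keeping the top
  per-mode box faces of P1 robust (`4π²ν|k|₂² > ν(1+|k|₁)²`).

## The assembly (this file; ≈ 450 lines of proof, no analysis — all analysis is in P2, all dynamics in P1)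

Per `ν`: data `(A, θ, δ, G)` of P1; sweeping scale `M` of P2 for them; a robust block of P1 at a level `m ≥ M`;
`N₀ := m`.  At every `N ≥ m` the LIFTED block on the phase space of order `N` has low faces `h i ∘ P` (`P` = restriction
to `|k| ≤ m`, `relabel`), tail faces `â_k² − ‖x k‖²` for `m² < |k|² ≤ N²` (enumerated by `tailEnum`), `M_N` = mean-zero
vectors (closed, invariant: `stub_meanZeroInvariant`).  Clauses of p119366: continuity; derivatives along the flow by
the chain rule from the Galerkin ODE (`hasDerivAt_liftFace`); the lifted block lies in the profile box (`box_of_mem`)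
hence P2 applies; low faces transversal by robustness against the actual coupling (`liftDeriv_inl_ne_zero`); tail
faces strict entrance (`liftDeriv_inr_pos`); NON-RETRACTION TRANSFER (`not_retract_lift`): the zero extension
`ι : B_m → B_N` and `P` intertwine block and exit sets — exit SIGNS of low faces at `ι y` / `P x` agree with the level-`m`
signs because an affine function without zeros on `[0,1]` has constant sign (`neg_iff_neg_of_forall_add_mul_ne_zero`,
`neg_iff_neg_of_robust`), so a retraction `r` at level `N` would descend to `P ∘ r ∘ ι` at level `m`
(`not_retract_of_section`); window by splitting the three sums into `|k| ≤ m` and tail (`sum_freqBall_split`,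
`window_of_mem`; the force has no tail mode).  `faces_pos`: the faceless (degenerate) instance is impossible — the
typed form of "X does not embed into P1".

## Why the pieces are not the crux / the summit reworded (BC2 (c))

`X ⇏ P1` in kind (a soft forward-invariant set at every level gives no transversal faces, no robustness, no exit-set
topology; with `M` hardwired to a subspace and `faces_pos` there is no slot for an invariant set); `P1 ⇏ X` except
through P2 and this file; `P2` is a ∀-inequality about finite convolutions.  Cheap probes `P1/P2 → AnomalousDissipation`,
`P1/P2 → UniformGalerkinTrap` (`first | exact? | simpa | aesop`) fail (strategist folder `bc/`).

References: Zgliczyński–Mischaikow, FoCM 1 (2001) 255–288, §2 Def 2.11 (C4a), Thm 2.12, §3 (self-consistent bounds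
for dissipative PDEs); Zgliczyński, TMNA 24 (2004) (KS periodic orbits); Conley 1978 Ch. II; Ważewski 1947;
Foias–Temam, JFA 87 (1989) (Gevrey class); tree: p119366, p105977, p108128, p108198, p137304.
-/

noncomputable section

-- `Summit.<Summit>.<Problem>` is the tree's mandated summit-side namespace (CONVENTIONS §2); deliberate duplicate.
set_option linter.dupNamespace false

/-! # PART I — piece P2 `UniformTailEstimates`, proved -/

namespace Summit.AnomalousDissipation.AnomalousDissipation.Cruxes.UniformGalerkinTrap.TailLift.P2

open scoped InnerProductSpace ENNReal NNReal
open MeasureTheory Set Filter Topology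
open Literature.Analysis.FunctionSpaces Literature.Analysis.FunctionSpaces.Torus
open Literature.Analysis.FluidPDE Literature.Analysis.FluidPDE.Torus

/-! ## §1 The ℓ¹ size of a frequency and elementary inequalities -/

/-- `|k|₁ = ∑ᵢ |kᵢ|` as a natural number. -/
def l1 (k : Fin 3 → ℤ) : ℕ := ∑ i, (k i).natAbs

theorem l1_nonneg_real (k : Fin 3 → ℤ) : (0 : ℝ) ≤ l1 k := Nat.cast_nonneg _

theorem cast_l1 (k : Fin 3 → ℤ) : ((l1 k : ℕ) : ℝ) = ∑ i, |((k i : ℤ) : ℝ)| := by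
  unfold l1
  push_cast
  refine Finset.sum_congr rfl fun i _ => ?_
  rw [Nat.cast_natAbs, Int.cast_abs]

theorem l1_neg (k : Fin 3 → ℤ) : l1 (-k) = l1 k := by
  unfold l1; simp

theorem l1_add_le (k l : Fin 3 → ℤ) : l1 (k + l) ≤ l1 k + l1 l := by
  unfold l1
  rw [← Finset.sum_add_distrib]
  exact Finset.sum_le_sum fun i _ => Int.natAbs_add_le _ _

theorem l1_sub_le (k l : Fin 3 → ℤ) : l1 (k - l) ≤ l1 k + l1 l := by
  have := l1_add_le k (-l)
  rwa [l1_neg, ← sub_eq_add_neg] at this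

theorem l1_le_l1_sub_add (k l : Fin 3 → ℤ) : l1 k ≤ l1 (k - l) + l1 l := by
  have := l1_add_le (k - l) l
  rwa [sub_add_cancel] at this

/-- `|k|₂² ≤ |k|₁²`. -/
theorem freqNormSq_le_l1_sq (k : Fin 3 → ℤ) : freqNormSq k ≤ ((l1 k : ℕ) : ℝ) ^ 2 := by
  rw [cast_l1, freqNormSq]
  have h : ∀ i, ((k i : ℤ) : ℝ) ^ 2 = |((k i : ℤ) : ℝ)| ^ 2 := fun i => (sq_abs _).symm
  simp_rw [h]
  exact Finset.sum_sq_le_sq_sum_of_nonneg fun i _ => abs_nonneg _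

/-- `|k|₁² ≤ 3 |k|₂²` (Cauchy–Schwarz on three coordinates). -/
theorem l1_sq_le_three_mul_freqNormSq (k : Fin 3 → ℤ) : ((l1 k : ℕ) : ℝ) ^ 2 ≤ 3 * freqNormSq k := by
  rw [cast_l1, freqNormSq, Fin.sum_univ_three, Fin.sum_univ_three]
  have h0 := sq_abs ((k 0 : ℤ) : ℝ); have h1 := sq_abs ((k 1 : ℤ) : ℝ); have h2 := sq_abs ((k 2 : ℤ) : ℝ)
  nlinarith [sq_nonneg (|((k 0 : ℤ) : ℝ)| - |((k 1 : ℤ) : ℝ)|), sq_nonneg (|((k 1 : ℤ) : ℝ)| - |((k 2 : ℤ) : ℝ)|),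
    sq_nonneg (|((k 0 : ℤ) : ℝ)| - |((k 2 : ℤ) : ℝ)|)]

/-- A frequency with `m² < |k|₂²` has `m + 1 ≤ |k|₁`. -/
theorem succ_le_l1_of_sq_lt {m : ℕ} {k : Fin 3 → ℤ} (h : ((m : ℕ) : ℝ) ^ 2 < freqNormSq k) : m + 1 ≤ l1 k := by
  have h2 : ((m : ℕ) : ℝ) ^ 2 < ((l1 k : ℕ) : ℝ) ^ 2 := h.trans_le (freqNormSq_le_l1_sq k)
  have h3 : (m : ℝ) < (l1 k : ℕ) := by
    exact lt_of_pow_lt_pow_left₀ 2 (Nat.cast_nonneg _) h2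
  exact_mod_cast h3

/-- A frequency in the ball `|k|₂² ≤ m²` has `|k|₁ ≤ 2 m` (indeed `≤ √3 m`). -/
theorem l1_le_two_mul_of_sq_le {m : ℕ} {k : Fin 3 → ℤ} (h : freqNormSq k ≤ ((m : ℕ) : ℝ) ^ 2) : l1 k ≤ 2 * m := by
  have h2 : ((l1 k : ℕ) : ℝ) ^ 2 ≤ 3 * ((m : ℕ) : ℝ) ^ 2 := (l1_sq_le_three_mul_freqNormSq k).trans (by linarith)
  have h3 : ((l1 k : ℕ) : ℝ) ^ 2 < ((2 * m + 1 : ℕ) : ℝ) ^ 2 := by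
    push_cast; nlinarith [Nat.cast_nonneg (α := ℝ) m]
  have h4 : ((l1 k : ℕ) : ℝ) < ((2 * m + 1 : ℕ) : ℝ) := lt_of_pow_lt_pow_left₀ 2 (Nat.cast_nonneg _) h3
  have h5 : l1 k < 2 * m + 1 := by exact_mod_cast h4
  omega

/-- Scalar part of the convection symbol: `|∑ⱼ cⱼ mⱼ| ≤ ‖c‖ |m|₁`. -/
theorem norm_sum_mul_le (c : EuclideanSpace ℂ (Fin 3)) (m : Fin 3 → ℤ) :
    ‖∑ j, c j * ((m j : ℤ) : ℂ)‖ ≤ ‖c‖ * ((l1 m : ℕ) : ℝ) := by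
  rw [cast_l1, Finset.mul_sum]
  refine (norm_sum_le _ _).trans (Finset.sum_le_sum fun j _ => ?_)
  rw [norm_mul, Complex.norm_intCast]
  exact mul_le_mul_of_nonneg_right (PiLp.norm_apply_le c j) (abs_nonneg _)

/-! ## §2 The lattice sum `∑ (1+|j|₁)^{-6}` is bounded uniformly over finite sets -/

/-- The one-dimensional majorant `(1+|n|)^{-2}` on `ℤ`. -/
def w1 (n : ℤ) : ℝ := ((1 + |(n : ℝ)|) ^ 2)⁻¹

theorem w1_nonneg (n : ℤ) : 0 ≤ w1 n := by unfold w1; positivity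

theorem summable_w1 : Summable w1 := by
  have h1 : Summable fun n : ℤ => 1 / (n : ℝ) ^ 2 := Real.summable_one_div_int_pow.2 one_lt_two
  have h2 : Summable fun n : ℤ => if n = 0 then (1 : ℝ) else 0 :=
    summable_of_ne_finset_zero (s := {0}) (by intro b hb; simp [Finset.mem_singleton] at hb; simp [hb])
  refine (h1.add h2).of_nonneg_of_le w1_nonneg fun n => ?_
  unfold w1
  by_cases hn : n = 0
  · subst hn; simp
  · simp only [hn, if_false, add_zero, one_div]
    have h0 : (0 : ℝ) < |(n : ℝ)| := by
      rw [abs_pos]; exact_mod_cast hn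
    rw [← sq_abs (n : ℝ)]
    exact inv_anti₀ (by positivity) (by nlinarith)

/-- The lattice constant `C = (∑_{n∈ℤ} (1+|n|)^{-2})³`. -/
def latC : ℝ := (∑' n : ℤ, w1 n) ^ 3

theorem latC_nonneg : 0 ≤ latC := pow_nonneg (tsum_nonneg w1_nonneg) 3

theorem sum_w1_le (s : Finset ℤ) : ∑ n ∈ s, w1 n ≤ ∑' n : ℤ, w1 n :=
  summable_w1.sum_le_tsum s fun n _ => w1_nonneg n

/-- `(1+|j|₁)³ ≥ ∏ᵢ (1+|jᵢ|)` (expand the cube). -/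
theorem prod_le_cube (j : Fin 3 → ℤ) : ∏ i, (1 + |((j i : ℤ) : ℝ)|) ≤ (1 + ((l1 j : ℕ) : ℝ)) ^ 3 := by
  rw [cast_l1, Fin.prod_univ_three, Fin.sum_univ_three]
  set a := |((j 0 : ℤ) : ℝ)|; set b := |((j 1 : ℤ) : ℝ)|; set c := |((j 2 : ℤ) : ℝ)|
  have ha : 0 ≤ a := abs_nonneg _; have hb : 0 ≤ b := abs_nonneg _; have hc : 0 ≤ c := abs_nonneg _
  nlinarith [mul_nonneg ha hb, mul_nonneg hb hc, mul_nonneg ha hc, mul_nonneg (mul_nonneg ha hb) hc,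
    mul_nonneg (mul_nonneg ha ha) ha, mul_nonneg (mul_nonneg hb hb) hb, mul_nonneg (mul_nonneg hc hc) hc,
    mul_nonneg (mul_nonneg ha ha) hb, mul_nonneg (mul_nonneg ha ha) hc, mul_nonneg (mul_nonneg hb hb) ha,
    mul_nonneg (mul_nonneg hb hb) hc, mul_nonneg (mul_nonneg hc hc) ha, mul_nonneg (mul_nonneg hc hc) hb]

/-- Pointwise: `(1+|j|₁)^{-6} ≤ ∏ᵢ (1+|jᵢ|)^{-2}`. -/
theorem inv_pow_six_le_prod (j : Fin 3 → ℤ) :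
    ((1 + ((l1 j : ℕ) : ℝ)) ^ 6)⁻¹ ≤ ∏ i, w1 (j i) := by
  have hp : ∏ i, w1 (j i) = ((∏ i, (1 + |((j i : ℤ) : ℝ)|)) ^ 2)⁻¹ := by
    unfold w1
    rw [Finset.prod_inv_distrib, ← Finset.prod_pow]
  rw [hp]
  have h0 : 0 < ∏ i, (1 + |((j i : ℤ) : ℝ)|) := Finset.prod_pos fun i _ => by positivity
  refine inv_anti₀ (by positivity) ?_
  calc (∏ i, (1 + |((j i : ℤ) : ℝ)|)) ^ 2 ≤ ((1 + ((l1 j : ℕ) : ℝ)) ^ 3) ^ 2 :=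
        pow_le_pow_left₀ h0.le (prod_le_cube j) 2
    _ = (1 + ((l1 j : ℕ) : ℝ)) ^ 6 := by ring

/-- **Uniform bound of the lattice sum**: for every finite `T ⊂ ℤ³`, `∑_{j∈T} (1+|j|₁)^{-6} ≤ C`. -/
theorem latticeSum_le (T : Finset (Fin 3 → ℤ)) :
    ∑ j ∈ T, ((1 + ((l1 j : ℕ) : ℝ)) ^ 6)⁻¹ ≤ latC := by
  classical
  -- a box containing T
  obtain ⟨R, hR⟩ : ∃ R : ℤ, ∀ j ∈ T, ∀ i, |j i| ≤ R := by
    refine ⟨∑ j ∈ T, ∑ i, |j i|, fun j hj i => ?_⟩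
    exact (Finset.single_le_sum (f := fun i => |j i|) (fun _ _ => abs_nonneg _) (Finset.mem_univ i)).trans
      (Finset.single_le_sum (f := fun j => ∑ i, |j i|) (fun _ _ => Finset.sum_nonneg fun _ _ => abs_nonneg _) hj)
  set box : Finset (Fin 3 → ℤ) := Fintype.piFinset fun _ : Fin 3 => Finset.Icc (-R) R with hbox
  have hT : T ⊆ box := by
    intro j hj
    rw [hbox, Fintype.mem_piFinset]
    intro i
    rw [Finset.mem_Icc]
    exact abs_le.1 (hR j hj i)
  calc ∑ j ∈ T, ((1 + ((l1 j : ℕ) : ℝ)) ^ 6)⁻¹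
      ≤ ∑ j ∈ T, ∏ i, w1 (j i) := Finset.sum_le_sum fun j _ => inv_pow_six_le_prod j
    _ ≤ ∑ j ∈ box, ∏ i, w1 (j i) :=
        Finset.sum_le_sum_of_subset_of_nonneg hT fun j _ _ => Finset.prod_nonneg fun i _ => w1_nonneg _
    _ = ∏ _i : Fin 3, ∑ n ∈ Finset.Icc (-R) R, w1 n := by
        rw [hbox, Finset.prod_univ_sum]
    _ ≤ ∏ _i : Fin 3, ∑' n : ℤ, w1 n := by
        refine Finset.prod_le_prod (fun i _ => Finset.sum_nonneg fun n _ => w1_nonneg n) fun i _ => sum_w1_le _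
    _ = latC := by rw [Finset.prod_const, Finset.card_univ, Fintype.card_fin]; rfl

/-- Shifted version: `∑_{j∈T} (1+|c - j|₁)^{-6} ≤ C`. -/
theorem latticeSum_shift_le (T : Finset (Fin 3 → ℤ)) (c : Fin 3 → ℤ) :
    ∑ j ∈ T, ((1 + ((l1 (c - j) : ℕ) : ℝ)) ^ 6)⁻¹ ≤ latC := by
  classical
  have hinj : Set.InjOn (fun j => c - j) T := fun a _ b _ h => by simpa using h
  rw [← Finset.sum_image (g := fun j => c - j) (f := fun i => ((1 + ((l1 i : ℕ) : ℝ)) ^ 6)⁻¹) hinj]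
  exact latticeSum_le _

/-! ## §3 The profile, the coupling majorant, and the key weighted lattice sum -/

/-- The Gevrey-type profile `A θ^{|k|₁} (1+|k|₁)^{-6}` (verbatim as in the pieces). -/
def prof (A θ : ℝ) (k : Fin 3 → ℤ) : ℝ :=
  A * θ ^ (∑ i, (k i).natAbs) / (1 + ∑ i, ((k i).natAbs : ℝ)) ^ 6

/-- The modewise coupling majorant `ν A θ^{max(|k|₁,m)} (1+max(|k|₁,m))^{-4}` (verbatim as in the pieces). -/
def cpl (ν A θ : ℝ) (m : ℕ) (k : Fin 3 → ℤ) : ℝ :=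
  ν * A * θ ^ (max (∑ i, (k i).natAbs) m) / (1 + ((max (∑ i, (k i).natAbs) m : ℕ) : ℝ)) ^ 4

theorem prof_eq (A θ : ℝ) (k : Fin 3 → ℤ) : prof A θ k = A * θ ^ (l1 k) / (1 + ((l1 k : ℕ) : ℝ)) ^ 6 := by
  unfold prof l1; push_cast; rfl

theorem cpl_eq (ν A θ : ℝ) (m : ℕ) (k : Fin 3 → ℤ) :
    cpl ν A θ m k = ν * A * θ ^ (max (l1 k) m) / (1 + ((max (l1 k) m : ℕ) : ℝ)) ^ 4 := rfl

theorem prof_pos {A θ : ℝ} (hA : 0 < A) (hθ : 0 < θ) (k : Fin 3 → ℤ) : 0 < prof A θ k := by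
  rw [prof_eq]; positivity

theorem prof_nonneg {A θ : ℝ} (hA : 0 ≤ A) (hθ : 0 ≤ θ) (k : Fin 3 → ℤ) : 0 ≤ prof A θ k := by
  rw [prof_eq]; positivity

/-- abbreviation: `q n = (1 + n)` as a real, the polynomial weight base. -/
theorem one_add_pos (n : ℕ) : (0 : ℝ) < 1 + (n : ℝ) := by positivity

/-- **Product of two profile values against the `|l'|₁` weight** (`θ ≤ 1`):
`prof(k - l') · |l'|₁ · prof(l') ≤ A² θ^{|k|₁} (1+|k-l'|₁)^{-6} (1+|l'|₁)^{-5}`. -/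
theorem prof_mul_l1_mul_prof_le {A θ : ℝ} (_hA : 0 ≤ A) (hθ : 0 ≤ θ) (hθ1 : θ ≤ 1) (k l' : Fin 3 → ℤ) :
    prof A θ (k - l') * ((l1 l' : ℕ) : ℝ) * prof A θ l' ≤
      A ^ 2 * θ ^ (l1 k) * (((1 + ((l1 (k - l') : ℕ) : ℝ)) ^ 6)⁻¹ * ((1 + ((l1 l' : ℕ) : ℝ)) ^ 5)⁻¹) := by
  rw [prof_eq, prof_eq]
  have hpow : θ ^ (l1 (k - l')) * θ ^ (l1 l') ≤ θ ^ (l1 k) := by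
    rw [← pow_add]
    exact pow_le_pow_of_le_one hθ hθ1 (l1_le_l1_sub_add k l')
  set a : ℝ := 1 + ((l1 (k - l') : ℕ) : ℝ) with ha
  set b : ℝ := 1 + ((l1 l' : ℕ) : ℝ) with hb
  have ha0 : 0 < a := by rw [ha]; positivity
  have hb0 : 0 < b := by rw [hb]; positivity
  have hlb : ((l1 l' : ℕ) : ℝ) ≤ b := by rw [hb]; linarith
  have hθk : 0 ≤ θ ^ (l1 k) := pow_nonneg hθ _
  -- rewrite both sides as products and compare factor by factor
  have lhs_eq : A * θ ^ l1 (k - l') / a ^ 6 * ((l1 l' : ℕ) : ℝ) * (A * θ ^ l1 l' / b ^ 6) =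
      A ^ 2 * (θ ^ l1 (k - l') * θ ^ l1 l') * ((a ^ 6)⁻¹ * (((l1 l' : ℕ) : ℝ) * (b ^ 6)⁻¹)) := by
    field_simp
  rw [lhs_eq]
  have h5 : ((l1 l' : ℕ) : ℝ) * (b ^ 6)⁻¹ ≤ (b ^ 5)⁻¹ := by
    rw [← div_eq_mul_inv, div_le_iff₀ (by positivity)]
    calc ((l1 l' : ℕ) : ℝ) ≤ b := hlb
      _ = (b ^ 5)⁻¹ * b ^ 6 := by field_simp
  gcongr

/-- **The key weighted lattice sum.** For every finite `T`, centre `k` and floor `m`: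
`∑_{l'∈T, m ≤ |l'|₁} (1+|k-l'|₁)^{-6} (1+|l'|₁)^{-5} ≤ 96 C (1+max(|k|₁,m))^{-5}`
(regions `2|l'|₁ ≥ |k|₁` — use the `(1+|l'|₁)^{-5}` factor — and `2|l'|₁ < |k|₁` — there `|k-l'|₁ > |k|₁/2` and one
power of `(1+|l'|₁)` is spent against `(1+|k|₁)`). -/
theorem keySum_le (T : Finset (Fin 3 → ℤ)) (k : Fin 3 → ℤ) (m : ℕ) :
    ∑ l' ∈ T.filter (fun l' => m ≤ l1 l'),
        ((1 + ((l1 (k - l') : ℕ) : ℝ)) ^ 6)⁻¹ * ((1 + ((l1 l' : ℕ) : ℝ)) ^ 5)⁻¹ ≤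
      96 * latC * ((1 + ((max (l1 k) m : ℕ) : ℝ)) ^ 5)⁻¹ := by
  classical
  set F := T.filter (fun l' => m ≤ l1 l') with hF
  set P : ℝ := 1 + ((max (l1 k) m : ℕ) : ℝ) with hP
  have hP0 : 0 < P := by rw [hP]; positivity
  rw [← Finset.sum_filter_add_sum_filter_not F (fun l' => l1 k ≤ 2 * l1 l')]
  -- region 1
  have h1 : ∑ l' ∈ F.filter (fun l' => l1 k ≤ 2 * l1 l'),
      ((1 + ((l1 (k - l') : ℕ) : ℝ)) ^ 6)⁻¹ * ((1 + ((l1 l' : ℕ) : ℝ)) ^ 5)⁻¹ ≤ 32 * latC * (P ^ 5)⁻¹ := by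
    calc ∑ l' ∈ F.filter (fun l' => l1 k ≤ 2 * l1 l'),
          ((1 + ((l1 (k - l') : ℕ) : ℝ)) ^ 6)⁻¹ * ((1 + ((l1 l' : ℕ) : ℝ)) ^ 5)⁻¹
        ≤ ∑ l' ∈ F.filter (fun l' => l1 k ≤ 2 * l1 l'),
          ((1 + ((l1 (k - l') : ℕ) : ℝ)) ^ 6)⁻¹ * (32 * (P ^ 5)⁻¹) := by
          refine Finset.sum_le_sum fun l' hl' => ?_
          rw [Finset.mem_filter, hF, Finset.mem_filter] at hl'
          obtain ⟨⟨-, hm⟩, hk⟩ := hl'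
          refine mul_le_mul_of_nonneg_left ?_ (by positivity)
          -- 2 (1 + |l'|₁) ≥ P
          have hb : P ≤ 2 * (1 + ((l1 l' : ℕ) : ℝ)) := by
            rw [hP]
            have : (max (l1 k) m : ℝ) ≤ 2 * (l1 l' : ℕ) := by
              refine max_le ?_ ?_
              · exact_mod_cast hk
              · have : (m : ℝ) ≤ (l1 l' : ℕ) := by exact_mod_cast hm
                linarith
            push_cast at this ⊢
            linarith
          rw [show (32 : ℝ) * (P ^ 5)⁻¹ = ((P / 2) ^ 5)⁻¹ by field_simp; ring]
          exact inv_anti₀ (by positivity) (pow_le_pow_left₀ (by positivity) (by linarith) 5)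
      _ = 32 * (P ^ 5)⁻¹ * ∑ l' ∈ F.filter (fun l' => l1 k ≤ 2 * l1 l'), ((1 + ((l1 (k - l') : ℕ) : ℝ)) ^ 6)⁻¹ := by
          rw [Finset.mul_sum]; refine Finset.sum_congr rfl fun _ _ => by ring
      _ ≤ 32 * (P ^ 5)⁻¹ * latC :=
          mul_le_mul_of_nonneg_left (latticeSum_shift_le _ k) (by positivity)
      _ = 32 * latC * (P ^ 5)⁻¹ := by ring
  -- region 2
  have h2 : ∑ l' ∈ F.filter (fun l' => ¬ l1 k ≤ 2 * l1 l'),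
      ((1 + ((l1 (k - l') : ℕ) : ℝ)) ^ 6)⁻¹ * ((1 + ((l1 l' : ℕ) : ℝ)) ^ 5)⁻¹ ≤ 64 * latC * (P ^ 5)⁻¹ := by
    calc ∑ l' ∈ F.filter (fun l' => ¬ l1 k ≤ 2 * l1 l'),
          ((1 + ((l1 (k - l') : ℕ) : ℝ)) ^ 6)⁻¹ * ((1 + ((l1 l' : ℕ) : ℝ)) ^ 5)⁻¹
        ≤ ∑ l' ∈ F.filter (fun l' => ¬ l1 k ≤ 2 * l1 l'),
          (64 * (P ^ 5)⁻¹) * ((1 + ((l1 l' : ℕ) : ℝ)) ^ 6)⁻¹ := by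
          refine Finset.sum_le_sum fun l' hl' => ?_
          rw [Finset.mem_filter, hF, Finset.mem_filter] at hl'
          obtain ⟨⟨-, hm⟩, hk⟩ := hl'
          push Not at hk
          -- here ρ = |k|₁, |k - l'|₁ > |k|₁ / 2 and |l'|₁ ≤ ρ
          have hρ : max (l1 k) m = l1 k := max_eq_left (by omega)
          have hkl : l1 k ≤ l1 (k - l') + l1 l' := l1_le_l1_sub_add k l'
          have ha : P ≤ 2 * (1 + ((l1 (k - l') : ℕ) : ℝ)) := by
            rw [hP, hρ]
            have : l1 k + 1 ≤ 2 * l1 (k - l') + 2 := by omega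
            have : ((l1 k : ℕ) : ℝ) + 1 ≤ 2 * ((l1 (k - l') : ℕ) : ℝ) + 2 := by exact_mod_cast this
            linarith
          have hb : ((l1 l' : ℕ) : ℝ) + 1 ≤ P := by
            rw [hP, hρ]
            have : l1 l' + 1 ≤ 1 + l1 k := by omega
            exact_mod_cast this
          set a : ℝ := 1 + ((l1 (k - l') : ℕ) : ℝ)
          set b : ℝ := 1 + ((l1 l' : ℕ) : ℝ)
          have ha0 : 0 < a := by positivity
          have hb0 : 0 < b := by positivity
          have e1 : (a ^ 6)⁻¹ ≤ 64 * (P ^ 6)⁻¹ := by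
            rw [show (64 : ℝ) * (P ^ 6)⁻¹ = ((P / 2) ^ 6)⁻¹ by field_simp; ring]
            exact inv_anti₀ (by positivity) (pow_le_pow_left₀ (by positivity) (by linarith) 6)
          have e2 : (b ^ 5)⁻¹ ≤ P * (b ^ 6)⁻¹ := by
            rw [le_mul_inv_iff₀ (by positivity)]
            calc (b ^ 5)⁻¹ * b ^ 6 = b := by field_simp
              _ ≤ P := by linarith
          calc (a ^ 6)⁻¹ * (b ^ 5)⁻¹ ≤ (64 * (P ^ 6)⁻¹) * (P * (b ^ 6)⁻¹) := by gcongr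
            _ = 64 * (P ^ 5)⁻¹ * (b ^ 6)⁻¹ := by field_simp
      _ = 64 * (P ^ 5)⁻¹ * ∑ l' ∈ F.filter (fun l' => ¬ l1 k ≤ 2 * l1 l'), ((1 + ((l1 l' : ℕ) : ℝ)) ^ 6)⁻¹ := by
          rw [Finset.mul_sum]
      _ ≤ 64 * (P ^ 5)⁻¹ * latC := mul_le_mul_of_nonneg_left (latticeSum_le _) (by positivity)
      _ = 64 * latC * (P ^ 5)⁻¹ := by ring
  linarith

/-! ## §4 The convection symbol against the profile box -/

/-- **Norm of the convection symbol**: `‖B(c,c')_k‖ ≤ 2π ∑_{l'∈S} ‖c (k-l')‖ |l'|₁ ‖c' l'‖` (the `l`-sum collapses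
on `l = k - l'`; dropping the constraint `k - l' ∈ S` only enlarges the bound). [folklore] -/
theorem norm_convectionCoeff_le (S : Finset (Fin 3 → ℤ)) (c c' : (Fin 3 → ℤ) → EuclideanSpace ℂ (Fin 3))
    (k : Fin 3 → ℤ) :
    ‖convectionCoeff S c c' k‖ ≤ 2 * Real.pi * ∑ l' ∈ S, ‖c (k - l')‖ * ((l1 l' : ℕ) : ℝ) * ‖c' l'‖ := by
  classical
  rw [convectionCoeff_def]
  calc ‖∑ l ∈ S, ∑ m ∈ S, (if l + m = k then (2 * Real.pi * Complex.I * ∑ j, c l j * ((m j : ℤ) : ℂ)) • c' m else 0)‖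
      ≤ ∑ l ∈ S, ‖∑ m ∈ S, (if l + m = k then (2 * Real.pi * Complex.I * ∑ j, c l j * ((m j : ℤ) : ℂ)) • c' m else 0)‖ :=
        norm_sum_le _ _
    _ ≤ ∑ l ∈ S, ∑ m ∈ S, ‖(if l + m = k then (2 * Real.pi * Complex.I * ∑ j, c l j * ((m j : ℤ) : ℂ)) • c' m else 0)‖ :=
        Finset.sum_le_sum fun l _ => norm_sum_le _ _
    _ ≤ ∑ l ∈ S, ∑ m ∈ S, (if l = k - m then 2 * Real.pi * (‖c l‖ * ((l1 m : ℕ) : ℝ) * ‖c' m‖) else 0) := by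
        refine Finset.sum_le_sum fun l _ => Finset.sum_le_sum fun m _ => ?_
        by_cases h : l + m = k
        · have h' : l = k - m := by rw [← h]; abel
          rw [if_pos h, if_pos h', norm_smul]
          have hs : ‖2 * (Real.pi : ℂ) * Complex.I * ∑ j, c l j * ((m j : ℤ) : ℂ)‖ ≤ 2 * Real.pi * (‖c l‖ * ((l1 m : ℕ) : ℝ)) := by
            rw [norm_mul, norm_mul, norm_mul, Complex.norm_I, mul_one, Complex.norm_real, Real.norm_eq_abs,
              abs_of_pos Real.pi_pos, Complex.norm_ofNat]
            exact mul_le_mul_of_nonneg_left (norm_sum_mul_le (c l) m) (by positivity)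
          calc ‖2 * (Real.pi : ℂ) * Complex.I * ∑ j, c l j * ((m j : ℤ) : ℂ)‖ * ‖c' m‖
              ≤ 2 * Real.pi * (‖c l‖ * ((l1 m : ℕ) : ℝ)) * ‖c' m‖ := mul_le_mul_of_nonneg_right hs (norm_nonneg _)
            _ = 2 * Real.pi * (‖c l‖ * ((l1 m : ℕ) : ℝ) * ‖c' m‖) := by ring
        · have h' : ¬ l = k - m := fun h' => h (by rw [h']; abel)
          rw [if_neg h, if_neg h', norm_zero]
    _ = ∑ m ∈ S, ∑ l ∈ S, (if l = k - m then 2 * Real.pi * (‖c l‖ * ((l1 m : ℕ) : ℝ) * ‖c' m‖) else 0) := Finset.sum_comm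
    _ = ∑ m ∈ S, (if k - m ∈ S then 2 * Real.pi * (‖c (k - m)‖ * ((l1 m : ℕ) : ℝ) * ‖c' m‖) else 0) := by
        refine Finset.sum_congr rfl fun m _ => ?_
        rw [Finset.sum_ite_eq' S (k - m) (fun l => 2 * Real.pi * (‖c l‖ * ((l1 m : ℕ) : ℝ) * ‖c' m‖))]
    _ ≤ ∑ m ∈ S, 2 * Real.pi * (‖c (k - m)‖ * ((l1 m : ℕ) : ℝ) * ‖c' m‖) := by
        refine Finset.sum_le_sum fun m _ => ?_
        split_ifs
        · exact le_rfl
        · positivity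
    _ = 2 * Real.pi * ∑ l' ∈ S, ‖c (k - l')‖ * ((l1 l' : ℕ) : ℝ) * ‖c' l'‖ := by rw [Finset.mul_sum]

/-- **The convection symbol inside the profile box**: if `‖c j‖ ≤ prof(j)` for all `j` then
`‖B(c,c)_k‖ ≤ 192 π C · A (1+|k|₁) · prof(k)`. -/
theorem norm_convectionCoeff_le_of_box {A θ : ℝ} (hA : 0 ≤ A) (hθ : 0 ≤ θ) (hθ1 : θ ≤ 1)
    (S : Finset (Fin 3 → ℤ)) (c : (Fin 3 → ℤ) → EuclideanSpace ℂ (Fin 3)) (hc : ∀ j, ‖c j‖ ≤ prof A θ j)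
    (k : Fin 3 → ℤ) :
    ‖convectionCoeff S c c k‖ ≤ 192 * Real.pi * latC * (A * (1 + ((l1 k : ℕ) : ℝ)) * prof A θ k) := by
  classical
  have hsum : ∑ l' ∈ S, ‖c (k - l')‖ * ((l1 l' : ℕ) : ℝ) * ‖c l'‖ ≤
      A ^ 2 * θ ^ (l1 k) * (96 * latC * ((1 + ((l1 k : ℕ) : ℝ)) ^ 5)⁻¹) := by
    calc ∑ l' ∈ S, ‖c (k - l')‖ * ((l1 l' : ℕ) : ℝ) * ‖c l'‖
        ≤ ∑ l' ∈ S, prof A θ (k - l') * ((l1 l' : ℕ) : ℝ) * prof A θ l' := by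
          refine Finset.sum_le_sum fun l' _ => ?_
          have h1 := hc (k - l'); have h2 := hc l'
          have : 0 ≤ prof A θ (k - l') := prof_nonneg hA hθ _
          gcongr
      _ ≤ ∑ l' ∈ S, A ^ 2 * θ ^ (l1 k) * (((1 + ((l1 (k - l') : ℕ) : ℝ)) ^ 6)⁻¹ * ((1 + ((l1 l' : ℕ) : ℝ)) ^ 5)⁻¹) :=
          Finset.sum_le_sum fun l' _ => prof_mul_l1_mul_prof_le hA hθ hθ1 k l'
      _ = A ^ 2 * θ ^ (l1 k) * ∑ l' ∈ S.filter (fun l' => 0 ≤ l1 l'),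
            ((1 + ((l1 (k - l') : ℕ) : ℝ)) ^ 6)⁻¹ * ((1 + ((l1 l' : ℕ) : ℝ)) ^ 5)⁻¹ := by
          rw [Finset.filter_true_of_mem fun l' _ => Nat.zero_le (l1 l'), Finset.mul_sum]
      _ ≤ A ^ 2 * θ ^ (l1 k) * (96 * latC * ((1 + ((max (l1 k) 0 : ℕ) : ℝ)) ^ 5)⁻¹) :=
          mul_le_mul_of_nonneg_left (keySum_le S k 0) (by positivity)
      _ = A ^ 2 * θ ^ (l1 k) * (96 * latC * ((1 + ((l1 k : ℕ) : ℝ)) ^ 5)⁻¹) := by rw [Nat.max_eq_left (Nat.zero_le _)]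
  calc ‖convectionCoeff S c c k‖ ≤ 2 * Real.pi * ∑ l' ∈ S, ‖c (k - l')‖ * ((l1 l' : ℕ) : ℝ) * ‖c l'‖ :=
        norm_convectionCoeff_le S c c k
    _ ≤ 2 * Real.pi * (A ^ 2 * θ ^ (l1 k) * (96 * latC * ((1 + ((l1 k : ℕ) : ℝ)) ^ 5)⁻¹)) :=
        mul_le_mul_of_nonneg_left hsum (by positivity)
    _ = 192 * Real.pi * latC * (A * (1 + ((l1 k : ℕ) : ℝ)) * prof A θ k) := by
        rw [prof_eq]
        field_simp
        ring

/-! ## §5 Clause (i): per-mode tail entrance -/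

/-- Real part of `⟪x, -a • x + L⟫` for a real scalar `a`. -/
theorem re_inner_neg_smul_add (x L : EuclideanSpace ℂ (Fin 3)) (a : ℝ) :
    (inner ℂ x (-(((a : ℝ) : ℂ) • x) + L)).re = -a * ‖x‖ ^ 2 + (inner ℂ x L).re := by
  rw [inner_add_right, inner_neg_right, inner_smul_right, Complex.add_re, Complex.neg_re, Complex.mul_re,
    Complex.ofReal_re, Complex.ofReal_im, zero_mul, sub_zero]
  have h := inner_self_eq_norm_sq (𝕜 := ℂ) x
  rw [RCLike.re_to_complex] at h
  rw [h]
  ring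

/-- Box bounds extend to the zero extension. -/
theorem norm_coeffExt_le_prof {A θ : ℝ} (hA : 0 ≤ A) (hθ : 0 ≤ θ) {S : Finset (Fin 3 → ℤ)}
    (x : ↥S → EuclideanSpace ℂ (Fin 3)) (hx : ∀ l : ↥S, ‖x l‖ ≤ prof A θ l) (j : Fin 3 → ℤ) :
    ‖coeffExt S x j‖ ≤ prof A θ j := by
  by_cases hj : j ∈ S
  · rw [coeffExt_of_mem x hj]; exact hx ⟨j, hj⟩
  · rw [coeffExt_of_not_mem x hj, norm_zero]; exact prof_nonneg hA hθ j

/-- **Clause (i).** Beyond the sweeping scale (`288 C A < π ν (m+1)`), a tail mode `m² < |k|²` with no force on it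
sitting on its box face `‖x k‖ = prof(k)`, with all modes inside the box, is a strict ENTRANCE face:
`Re⟪x k, (galerkinRHS ν g x) k⟫ < 0`. -/
theorem entrance_clause {ν A θ : ℝ} (hν : 0 < ν) (hA : 0 < A) (hθ : 0 < θ) (hθ1 : θ ≤ 1) {N m : ℕ}
    (hth : 288 * latC * A < Real.pi * ν * ((m : ℝ) + 1))
    (x g : ↥(freqBall N : Finset (Fin 3 → ℤ)) → EuclideanSpace ℂ (Fin 3))
    (hx : ∀ l : ↥(freqBall N : Finset (Fin 3 → ℤ)), ‖x l‖ ≤ prof A θ l)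
    (k : ↥(freqBall N : Finset (Fin 3 → ℤ))) (hk : ((m : ℕ) : ℝ) ^ 2 < freqNormSq (k : Fin 3 → ℤ))
    (hg : g k = 0) (hnorm : ‖x k‖ = prof A θ k) :
    (inner ℂ (x k) (galerkinRHS (freqBall N : Finset (Fin 3 → ℤ)) ν g x k)).re < 0 := by
  set L : ℝ := ((l1 (k : Fin 3 → ℤ) : ℕ) : ℝ) with hL
  set Q : ℝ := freqNormSq (k : Fin 3 → ℤ) with hQ
  set p : ℝ := prof A θ k with hp
  have hp0 : 0 < p := prof_pos hA hθ _
  have hpi : 0 < Real.pi := Real.pi_pos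
  have hC : 0 ≤ latC := latC_nonneg
  -- unfold the field at mode k
  rw [galerkinRHS_apply, galerkinField_def, coeffExt_coe, coeffExt_coe, hg, re_inner_neg_smul_add]
  -- the Leray / convection term
  have hconv : ‖convectionCoeff (freqBall N : Finset (Fin 3 → ℤ)) (coeffExt (freqBall N : Finset (Fin 3 → ℤ)) x)
      (coeffExt (freqBall N : Finset (Fin 3 → ℤ)) x) (k : Fin 3 → ℤ)‖ ≤ 192 * Real.pi * latC * (A * (1 + L) * p) :=
    norm_convectionCoeff_le_of_box hA.le hθ.le hθ1 _ _ (norm_coeffExt_le_prof hA.le hθ.le x hx) k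
  have hLer : (inner ℂ (x k) (leraySym (k : Fin 3 → ℤ)
      (0 - convectionCoeff (freqBall N : Finset (Fin 3 → ℤ)) (coeffExt (freqBall N : Finset (Fin 3 → ℤ)) x)
        (coeffExt (freqBall N : Finset (Fin 3 → ℤ)) x) (k : Fin 3 → ℤ)))).re ≤
      p * (192 * Real.pi * latC * (A * (1 + L) * p)) := by
    refine ((Complex.re_le_norm _).trans (norm_inner_le_norm _ _)).trans ?_
    rw [hnorm]
    refine mul_le_mul_of_nonneg_left ((norm_leraySym_le _ _).trans ?_) hp0.le
    rwa [zero_sub, norm_neg]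
  -- the threshold arithmetic: 192 π C A (1 + L) < 4 π² ν Q
  have hL1 : (m : ℝ) + 1 ≤ L := by
    have := succ_le_l1_of_sq_lt hk
    rw [hL]; exact_mod_cast this
  have hL0 : 1 ≤ L := le_trans (by linarith [Nat.cast_nonneg (α := ℝ) m]) hL1
  have hQ3 : L ^ 2 ≤ 3 * Q := l1_sq_le_three_mul_freqNormSq _
  have h1 : 288 * latC * A * L < Real.pi * ν * L ^ 2 := by
    have h1a : 288 * latC * A * L < Real.pi * ν * ((m : ℝ) + 1) * L := mul_lt_mul_of_pos_right hth (by linarith)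
    have h1b : Real.pi * ν * ((m : ℝ) + 1) * L ≤ Real.pi * ν * L * L :=
      mul_le_mul_of_nonneg_right (mul_le_mul_of_nonneg_left hL1 (by positivity)) (by linarith)
    nlinarith
  have key : 192 * Real.pi * latC * (A * (1 + L)) < ν * (4 * Real.pi ^ 2 * Q) := by
    calc 192 * Real.pi * latC * (A * (1 + L)) ≤ 192 * Real.pi * latC * (A * (2 * L)) := by gcongr; linarith
      _ = (4 * Real.pi / 3) * (288 * latC * A * L) := by ring
      _ < (4 * Real.pi / 3) * (Real.pi * ν * L ^ 2) := by gcongr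
      _ = (4 * Real.pi ^ 2 * ν / 3) * L ^ 2 := by ring
      _ ≤ (4 * Real.pi ^ 2 * ν / 3) * (3 * Q) := by gcongr
      _ = ν * (4 * Real.pi ^ 2 * Q) := by ring
  rw [hnorm]
  have h5 : p * (192 * Real.pi * latC * (A * (1 + L) * p)) = p ^ 2 * (192 * Real.pi * latC * (A * (1 + L))) := by ring
  have h6 : p ^ 2 * (192 * Real.pi * latC * (A * (1 + L))) < p ^ 2 * (ν * (4 * Real.pi ^ 2 * Q)) :=
    mul_lt_mul_of_pos_left key (by positivity)
  have h7 : -(ν * (4 * Real.pi ^ 2 * Q)) * p ^ 2 = -(p ^ 2 * (ν * (4 * Real.pi ^ 2 * Q))) := by ring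
  linarith [hLer, h5, h6, h7]

/-! ## §6 Clauses (iii)/(iv): the tail of the box is small -/

/-- One profile value in the tail, squared: `prof(k)² ≤ A² θ^{2m} (1+|k|₁)^{-6}` when `m ≤ |k|₁`. -/
theorem prof_sq_le_of_le {A θ : ℝ} (_hA : 0 ≤ A) (hθ : 0 ≤ θ) (hθ1 : θ ≤ 1) {m : ℕ} {k : Fin 3 → ℤ}
    (hm : m ≤ l1 k) : prof A θ k ^ 2 ≤ A ^ 2 * θ ^ (2 * m) * ((1 + ((l1 k : ℕ) : ℝ)) ^ 6)⁻¹ := by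
  rw [prof_eq]
  set Lr : ℝ := 1 + ((l1 k : ℕ) : ℝ) with hLr
  have hL0 : 1 ≤ Lr := by rw [hLr]; linarith [Nat.cast_nonneg (α := ℝ) (l1 k)]
  have hpow : θ ^ (l1 k) ≤ θ ^ m := pow_le_pow_of_le_one hθ hθ1 hm
  have e : (A * θ ^ l1 k / Lr ^ 6) ^ 2 = A ^ 2 * (θ ^ l1 k) ^ 2 * ((Lr ^ 6)⁻¹ * (Lr ^ 6)⁻¹) := by
    field_simp
  rw [e, show θ ^ (2 * m) = (θ ^ m) ^ 2 by rw [mul_comm, pow_mul]]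
  have h6 : (Lr ^ 6)⁻¹ ≤ 1 := inv_le_one_of_one_le₀ (one_le_pow₀ hL0)
  have h6' : 0 ≤ (Lr ^ 6)⁻¹ := by positivity
  calc A ^ 2 * (θ ^ l1 k) ^ 2 * ((Lr ^ 6)⁻¹ * (Lr ^ 6)⁻¹) ≤ A ^ 2 * (θ ^ m) ^ 2 * ((Lr ^ 6)⁻¹ * 1) := by
        gcongr
    _ = A ^ 2 * (θ ^ m) ^ 2 * (Lr ^ 6)⁻¹ := by ring

/-- The enstrophy weight costs two powers: `|k|₂² prof(k)² ≤ A² θ^{2m} (1+|k|₁)^{-6}` when `m ≤ |k|₁`. -/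
theorem freqNormSq_mul_prof_sq_le_of_le {A θ : ℝ} (_hA : 0 ≤ A) (hθ : 0 ≤ θ) (hθ1 : θ ≤ 1) {m : ℕ}
    {k : Fin 3 → ℤ} (hm : m ≤ l1 k) :
    freqNormSq k * prof A θ k ^ 2 ≤ A ^ 2 * θ ^ (2 * m) * ((1 + ((l1 k : ℕ) : ℝ)) ^ 6)⁻¹ := by
  rw [prof_eq]
  set Lr : ℝ := 1 + ((l1 k : ℕ) : ℝ) with hLr
  have hL0 : 1 ≤ Lr := by rw [hLr]; linarith [Nat.cast_nonneg (α := ℝ) (l1 k)]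
  have hQ : freqNormSq k ≤ Lr ^ 2 := by
    refine (freqNormSq_le_l1_sq k).trans ?_
    rw [hLr]; nlinarith [Nat.cast_nonneg (α := ℝ) (l1 k)]
  have hpow : θ ^ (l1 k) ≤ θ ^ m := pow_le_pow_of_le_one hθ hθ1 hm
  have e : (A * θ ^ l1 k / Lr ^ 6) ^ 2 = A ^ 2 * (θ ^ l1 k) ^ 2 * ((Lr ^ 2)⁻¹ * ((Lr ^ 4)⁻¹ * (Lr ^ 6)⁻¹)) := by
    field_simp
  rw [e, show θ ^ (2 * m) = (θ ^ m) ^ 2 by rw [mul_comm, pow_mul]]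
  have h4 : (Lr ^ 4)⁻¹ ≤ 1 := inv_le_one_of_one_le₀ (one_le_pow₀ hL0)
  have hQ0 : 0 ≤ freqNormSq k := by rw [freqNormSq]; positivity
  calc freqNormSq k * (A ^ 2 * (θ ^ l1 k) ^ 2 * ((Lr ^ 2)⁻¹ * ((Lr ^ 4)⁻¹ * (Lr ^ 6)⁻¹)))
      = (freqNormSq k * (Lr ^ 2)⁻¹) * (A ^ 2 * (θ ^ l1 k) ^ 2 * ((Lr ^ 4)⁻¹ * (Lr ^ 6)⁻¹)) := by ring
    _ ≤ 1 * (A ^ 2 * (θ ^ m) ^ 2 * (1 * (Lr ^ 6)⁻¹)) := by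
        gcongr
        rw [mul_inv_le_iff₀ (by positivity), one_mul]; exact hQ
    _ = A ^ 2 * (θ ^ m) ^ 2 * (Lr ^ 6)⁻¹ := by ring

theorem filter_freqBall_le {m N : ℕ} (hmN : m ≤ N) :
    (freqBall N : Finset (Fin 3 → ℤ)).filter (fun k => freqNormSq k ≤ ((m : ℕ) : ℝ) ^ 2) = freqBall m := by
  ext k
  simp only [Finset.mem_filter, mem_freqBall]
  exact ⟨fun hk => hk.2, fun hk => ⟨hk.trans (by gcongr), hk⟩⟩

/-- `∑_{|k| ≤ N} g = ∑_{|k| ≤ m} g + ∑_{|k| ≤ N} 𝟙{m² < |k|²} g` for `m ≤ N`. [folklore] -/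
theorem sum_freqBall_split {m N : ℕ} (hmN : m ≤ N) (g : (Fin 3 → ℤ) → ℝ) :
    ∑ k : ↥(freqBall N : Finset (Fin 3 → ℤ)), g k =
      ∑ l : ↥(freqBall m : Finset (Fin 3 → ℤ)), g l +
        ∑ k : ↥(freqBall N : Finset (Fin 3 → ℤ)), (if ((m : ℕ) : ℝ) ^ 2 < freqNormSq (k : Fin 3 → ℤ) then g k else 0) := by
  rw [Finset.sum_coe_sort (freqBall N) g, Finset.sum_coe_sort (freqBall m) g,
    Finset.sum_coe_sort (freqBall N) (fun k => if ((m : ℕ) : ℝ) ^ 2 < freqNormSq k then g k else 0),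
    ← Finset.sum_filter, ← filter_freqBall_le hmN,
    ← Finset.sum_filter_add_sum_filter_not (freqBall N) (fun k => freqNormSq k ≤ ((m : ℕ) : ℝ) ^ 2) g]
  congr 1
  refine Finset.sum_congr ?_ fun _ _ => rfl
  ext k
  simp only [Finset.mem_filter, not_le]

/-- Tail energy term of the box. -/
theorem tail_energy_le {A θ : ℝ} (hA : 0 ≤ A) (hθ : 0 ≤ θ) (hθ1 : θ ≤ 1) {m N : ℕ}
    (x : ↥(freqBall N : Finset (Fin 3 → ℤ)) → EuclideanSpace ℂ (Fin 3))
    (hx : ∀ l : ↥(freqBall N : Finset (Fin 3 → ℤ)), ‖x l‖ ≤ prof A θ l) :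
    ∑ k : ↥(freqBall N : Finset (Fin 3 → ℤ)),
        (if ((m : ℕ) : ℝ) ^ 2 < freqNormSq (k : Fin 3 → ℤ) then ‖x k‖ ^ 2 else 0) ≤ A ^ 2 * θ ^ (2 * m) * latC := by
  classical
  have step : ∀ k : ↥(freqBall N : Finset (Fin 3 → ℤ)),
      (if ((m : ℕ) : ℝ) ^ 2 < freqNormSq (k : Fin 3 → ℤ) then ‖x k‖ ^ 2 else 0) ≤
        A ^ 2 * θ ^ (2 * m) * ((1 + ((l1 (k : Fin 3 → ℤ) : ℕ) : ℝ)) ^ 6)⁻¹ := by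
    intro k
    split_ifs with hk
    · have hm : m ≤ l1 (k : Fin 3 → ℤ) := (Nat.le_succ m).trans (succ_le_l1_of_sq_lt hk)
      exact (pow_le_pow_left₀ (norm_nonneg _) (hx k) 2).trans (prof_sq_le_of_le hA hθ hθ1 hm)
    · positivity
  refine (Finset.sum_le_sum fun k _ => step k).trans ?_
  rw [← Finset.mul_sum, Finset.sum_coe_sort (freqBall N : Finset (Fin 3 → ℤ))
    (fun k => ((1 + ((l1 k : ℕ) : ℝ)) ^ 6)⁻¹)]
  exact mul_le_mul_of_nonneg_left (latticeSum_le _) (by positivity)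

/-- Tail enstrophy term of the box. -/
theorem tail_enstrophy_le {A θ : ℝ} (hA : 0 ≤ A) (hθ : 0 ≤ θ) (hθ1 : θ ≤ 1) {m N : ℕ}
    (x : ↥(freqBall N : Finset (Fin 3 → ℤ)) → EuclideanSpace ℂ (Fin 3))
    (hx : ∀ l : ↥(freqBall N : Finset (Fin 3 → ℤ)), ‖x l‖ ≤ prof A θ l) :
    ∑ k : ↥(freqBall N : Finset (Fin 3 → ℤ)),
        (if ((m : ℕ) : ℝ) ^ 2 < freqNormSq (k : Fin 3 → ℤ) then freqNormSq (k : Fin 3 → ℤ) * ‖x k‖ ^ 2 else 0) ≤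
      A ^ 2 * θ ^ (2 * m) * latC := by
  classical
  have step : ∀ k : ↥(freqBall N : Finset (Fin 3 → ℤ)),
      (if ((m : ℕ) : ℝ) ^ 2 < freqNormSq (k : Fin 3 → ℤ) then freqNormSq (k : Fin 3 → ℤ) * ‖x k‖ ^ 2 else 0) ≤
        A ^ 2 * θ ^ (2 * m) * ((1 + ((l1 (k : Fin 3 → ℤ) : ℕ) : ℝ)) ^ 6)⁻¹ := by
    intro k
    split_ifs with hk
    · have hm : m ≤ l1 (k : Fin 3 → ℤ) := (Nat.le_succ m).trans (succ_le_l1_of_sq_lt hk)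
      have hQ0 : 0 ≤ freqNormSq (k : Fin 3 → ℤ) := by rw [freqNormSq]; positivity
      exact (mul_le_mul_of_nonneg_left (pow_le_pow_left₀ (norm_nonneg _) (hx k) 2) hQ0).trans
        (freqNormSq_mul_prof_sq_le_of_le hA hθ hθ1 hm)
    · positivity
  refine (Finset.sum_le_sum fun k _ => step k).trans ?_
  rw [← Finset.mul_sum, Finset.sum_coe_sort (freqBall N : Finset (Fin 3 → ℤ))
    (fun k => ((1 + ((l1 k : ℕ) : ℝ)) ^ 6)⁻¹)]
  exact mul_le_mul_of_nonneg_left (latticeSum_le _) (by positivity)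

/-- **Clauses (iii)/(iv), quantitative form.** Inside the box, the energy and the enstrophy of order `N` exceed those
of the restriction to order `m ≤ N` by at most `½ A² θ^{2m} C` and `4π² A² θ^{2m} C`. -/
theorem tail_sums_le {A θ : ℝ} (hA : 0 ≤ A) (hθ : 0 ≤ θ) (hθ1 : θ ≤ 1) {m N : ℕ} (hmN : m ≤ N)
    (x : ↥(freqBall N : Finset (Fin 3 → ℤ)) → EuclideanSpace ℂ (Fin 3))
    (hx : ∀ l : ↥(freqBall N : Finset (Fin 3 → ℤ)), ‖x l‖ ≤ prof A θ l) :
    (2⁻¹ * ∑ k : ↥(freqBall N : Finset (Fin 3 → ℤ)), ‖x k‖ ^ 2 ≤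
      2⁻¹ * ∑ l : ↥(freqBall m : Finset (Fin 3 → ℤ)), ‖coeffExt (freqBall N : Finset (Fin 3 → ℤ)) x (l : Fin 3 → ℤ)‖ ^ 2 +
        2⁻¹ * (A ^ 2 * θ ^ (2 * m) * latC)) ∧
    (4 * Real.pi ^ 2 * ∑ k : ↥(freqBall N : Finset (Fin 3 → ℤ)), freqNormSq (k : Fin 3 → ℤ) * ‖x k‖ ^ 2 ≤
      4 * Real.pi ^ 2 * ∑ l : ↥(freqBall m : Finset (Fin 3 → ℤ)),
        freqNormSq (l : Fin 3 → ℤ) * ‖coeffExt (freqBall N : Finset (Fin 3 → ℤ)) x (l : Fin 3 → ℤ)‖ ^ 2 +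
        4 * Real.pi ^ 2 * (A ^ 2 * θ ^ (2 * m) * latC)) := by
  have eE := sum_freqBall_split hmN (fun k => ‖coeffExt (freqBall N : Finset (Fin 3 → ℤ)) x k‖ ^ 2)
  have eZ := sum_freqBall_split hmN (fun k => freqNormSq k * ‖coeffExt (freqBall N : Finset (Fin 3 → ℤ)) x k‖ ^ 2)
  simp only [coeffExt_coe] at eE eZ
  have tE := tail_energy_le (m := m) hA hθ hθ1 x hx
  have tZ := tail_enstrophy_le (m := m) hA hθ hθ1 x hx
  constructor
  · rw [eE, mul_add]
    linarith [mul_le_mul_of_nonneg_left tE (by norm_num : (0 : ℝ) ≤ 2⁻¹)]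
  · rw [eZ, mul_add]
    linarith [mul_le_mul_of_nonneg_left tZ (by positivity : (0 : ℝ) ≤ 4 * Real.pi ^ 2)]

/-! ## §7 Clause (ii): the modewise low/tail coupling -/

/-- Enlarging the frequency set does not change the convection symbol of families vanishing off the smaller set. -/
theorem convectionCoeff_subset_eq {S T : Finset (Fin 3 → ℤ)} (hST : S ⊆ T)
    (c c' : (Fin 3 → ℤ) → EuclideanSpace ℂ (Fin 3)) (hc : ∀ j ∉ S, c j = 0) (hc' : ∀ j ∉ S, c' j = 0)
    (k : Fin 3 → ℤ) : convectionCoeff S c c' k = convectionCoeff T c c' k := by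
  classical
  rw [convectionCoeff_def, convectionCoeff_def]
  refine Finset.sum_subset hST (fun l _ hl => ?_) |>.symm.trans ?_ |>.symm
  · refine Finset.sum_eq_zero fun m _ => ?_
    simp [hc l hl]
  · refine (Finset.sum_congr rfl fun l _ => Finset.sum_subset hST fun m _ hm => ?_).symm
    simp [hc' m hm]

/-- The `θ`-power of a pair one of whose members is beyond level `m`. -/
theorem pow_pair_le {θ : ℝ} (hθ : 0 ≤ θ) (hθ1 : θ ≤ 1) {m : ℕ} {k l' : Fin 3 → ℤ}
    (hm : m ≤ l1 (k - l') + l1 l') : θ ^ (l1 (k - l') + l1 l') ≤ θ ^ (max (l1 k) m) :=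
  pow_le_pow_of_le_one hθ hθ1 (max_le (l1_le_l1_sub_add k l') hm)

/-- Term bound of type (B): the OUTSIDE member is `l'` (`m+1 ≤ |l'|₁`), carrying the `|l'|₁` weight:
`prof(k-l') |l'|₁ prof(l') ≤ A² θ^{max(|k|₁,m)} (1+|k-l'|₁)^{-6} (1+|l'|₁)^{-5}`. -/
theorem termB_le {A θ : ℝ} (_hA : 0 ≤ A) (hθ : 0 ≤ θ) (hθ1 : θ ≤ 1) {m : ℕ} (k l' : Fin 3 → ℤ)
    (hl' : m + 1 ≤ l1 l') :
    prof A θ (k - l') * ((l1 l' : ℕ) : ℝ) * prof A θ l' ≤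
      A ^ 2 * θ ^ (max (l1 k) m) * (((1 + ((l1 (k - l') : ℕ) : ℝ)) ^ 6)⁻¹ * ((1 + ((l1 l' : ℕ) : ℝ)) ^ 5)⁻¹) := by
  rw [prof_eq, prof_eq]
  have hpow : θ ^ (l1 (k - l')) * θ ^ (l1 l') ≤ θ ^ (max (l1 k) m) := by
    rw [← pow_add]; exact pow_pair_le hθ hθ1 (by omega)
  set a : ℝ := 1 + ((l1 (k - l') : ℕ) : ℝ) with ha
  set b : ℝ := 1 + ((l1 l' : ℕ) : ℝ) with hb
  have ha0 : 0 < a := by rw [ha]; positivity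
  have hb0 : 0 < b := by rw [hb]; positivity
  have hlb : ((l1 l' : ℕ) : ℝ) ≤ b := by rw [hb]; linarith
  have hθk : 0 ≤ θ ^ (max (l1 k) m) := pow_nonneg hθ _
  have lhs_eq : A * θ ^ l1 (k - l') / a ^ 6 * ((l1 l' : ℕ) : ℝ) * (A * θ ^ l1 l' / b ^ 6) =
      A ^ 2 * (θ ^ l1 (k - l') * θ ^ l1 l') * ((a ^ 6)⁻¹ * (((l1 l' : ℕ) : ℝ) * (b ^ 6)⁻¹)) := by
    field_simp
  rw [lhs_eq]
  have h5 : ((l1 l' : ℕ) : ℝ) * (b ^ 6)⁻¹ ≤ (b ^ 5)⁻¹ := by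
    rw [← div_eq_mul_inv, div_le_iff₀ (by positivity)]
    calc ((l1 l' : ℕ) : ℝ) ≤ b := hlb
      _ = (b ^ 5)⁻¹ * b ^ 6 := by field_simp
  gcongr

/-- Term bound of type (A): the OUTSIDE member is `k - l'` (`m+1 ≤ |k-l'|₁`) while `|k|₁ ≤ 2m`, so the weight
`|l'|₁ ≤ |k|₁ + |k-l'|₁ ≤ 3(1+|k-l'|₁)` is paid by the outside member:
`prof(k-l') |l'|₁ prof(l') ≤ 3 A² θ^{max(|k|₁,m)} (1+|k-l'|₁)^{-5} (1+|l'|₁)^{-6}`. -/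
theorem termA_le {A θ : ℝ} (_hA : 0 ≤ A) (hθ : 0 ≤ θ) (hθ1 : θ ≤ 1) {m : ℕ} (k l' : Fin 3 → ℤ)
    (hk : l1 k ≤ 2 * m) (hl : m + 1 ≤ l1 (k - l')) :
    prof A θ (k - l') * ((l1 l' : ℕ) : ℝ) * prof A θ l' ≤
      3 * (A ^ 2 * θ ^ (max (l1 k) m) * (((1 + ((l1 (k - l') : ℕ) : ℝ)) ^ 5)⁻¹ * ((1 + ((l1 l' : ℕ) : ℝ)) ^ 6)⁻¹)) := by
  rw [prof_eq, prof_eq]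
  have hpow : θ ^ (l1 (k - l')) * θ ^ (l1 l') ≤ θ ^ (max (l1 k) m) := by
    rw [← pow_add]; exact pow_pair_le hθ hθ1 (by omega)
  have hw : l1 l' ≤ 3 * (1 + l1 (k - l')) := by
    have h1 : l1 l' ≤ l1 (l' - k) + l1 k := l1_le_l1_sub_add l' k
    have h2 : l1 (l' - k) = l1 (k - l') := by rw [← l1_neg, neg_sub]
    omega
  set a : ℝ := 1 + ((l1 (k - l') : ℕ) : ℝ) with ha
  set b : ℝ := 1 + ((l1 l' : ℕ) : ℝ) with hb
  have ha0 : 0 < a := by rw [ha]; positivity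
  have hb0 : 0 < b := by rw [hb]; positivity
  have hla : ((l1 l' : ℕ) : ℝ) ≤ 3 * a := by
    rw [ha]; exact_mod_cast hw
  have hθk : 0 ≤ θ ^ (max (l1 k) m) := pow_nonneg hθ _
  have lhs_eq : A * θ ^ l1 (k - l') / a ^ 6 * ((l1 l' : ℕ) : ℝ) * (A * θ ^ l1 l' / b ^ 6) =
      A ^ 2 * (θ ^ l1 (k - l') * θ ^ l1 l') * ((((l1 l' : ℕ) : ℝ) * (a ^ 6)⁻¹) * (b ^ 6)⁻¹) := by
    field_simp
  have rhs_eq : 3 * (A ^ 2 * θ ^ (max (l1 k) m) * ((a ^ 5)⁻¹ * (b ^ 6)⁻¹)) =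
      A ^ 2 * θ ^ (max (l1 k) m) * ((3 * (a ^ 5)⁻¹) * (b ^ 6)⁻¹) := by ring
  rw [lhs_eq, rhs_eq]
  have h5 : ((l1 l' : ℕ) : ℝ) * (a ^ 6)⁻¹ ≤ 3 * (a ^ 5)⁻¹ := by
    rw [← div_eq_mul_inv, div_le_iff₀ (by positivity)]
    calc ((l1 l' : ℕ) : ℝ) ≤ 3 * a := hla
      _ = 3 * (a ^ 5)⁻¹ * a ^ 6 := by field_simp
  gcongr

/-- **Clause (ii).** For `m ≤ N`, `x` of order `N` inside the box, `k` of order `m`, and the sweeping condition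
`768 π C A ≤ ν (m + 1)`: the `k`-th component of the order-`N` field differs from that of the order-`m` field of the
restriction by at most the coupling majorant `ν A θ^{max(|k|₁,m)} (1+max(|k|₁,m))^{-4}`. -/
theorem coupling_clause {ν A θ : ℝ} (hν : 0 < ν) (hA : 0 < A) (hθ : 0 < θ) (hθ1 : θ ≤ 1) {m N : ℕ}
    (hmN : m ≤ N) (hth : 768 * Real.pi * latC * A ≤ ν * ((m : ℝ) + 1))
    (x : ↥(freqBall N : Finset (Fin 3 → ℤ)) → EuclideanSpace ℂ (Fin 3))
    (hx : ∀ l : ↥(freqBall N : Finset (Fin 3 → ℤ)), ‖x l‖ ≤ prof A θ l)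
    (f : UnitAddTorus (Fin 3) → EuclideanSpace ℝ (Fin 3)) (k : ↥(freqBall m : Finset (Fin 3 → ℤ))) :
    ‖coeffExt (freqBall N : Finset (Fin 3 → ℤ)) (galerkinRHS (freqBall N : Finset (Fin 3 → ℤ)) ν
          (fourierRestrict (freqBall N : Finset (Fin 3 → ℤ)) f) x) (k : Fin 3 → ℤ) -
        galerkinRHS (freqBall m : Finset (Fin 3 → ℤ)) ν (fourierRestrict (freqBall m : Finset (Fin 3 → ℤ)) f)
          (fun l : ↥(freqBall m : Finset (Fin 3 → ℤ)) => coeffExt (freqBall N : Finset (Fin 3 → ℤ)) x (l : Fin 3 → ℤ)) k‖ ≤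
      cpl ν A θ m k := by
  classical
  have hsub : (freqBall m : Finset (Fin 3 → ℤ)) ⊆ freqBall N := freqBall_mono hmN
  have hkN : (k : Fin 3 → ℤ) ∈ (freqBall N : Finset (Fin 3 → ℤ)) := hsub k.2
  -- Step 1: the difference is the Leray symbol of the difference of the convection symbols
  have hdiff0 : coeffExt (freqBall N : Finset (Fin 3 → ℤ)) (galerkinRHS (freqBall N : Finset (Fin 3 → ℤ)) ν
        (fourierRestrict (freqBall N : Finset (Fin 3 → ℤ)) f) x) (k : Fin 3 → ℤ) -
      galerkinRHS (freqBall m : Finset (Fin 3 → ℤ)) ν (fourierRestrict (freqBall m : Finset (Fin 3 → ℤ)) f)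
        (fun l : ↥(freqBall m : Finset (Fin 3 → ℤ)) => coeffExt (freqBall N : Finset (Fin 3 → ℤ)) x (l : Fin 3 → ℤ)) k =
      leraySym (k : Fin 3 → ℤ)
        (convectionCoeff (freqBall m : Finset (Fin 3 → ℤ))
            (coeffExt (freqBall m : Finset (Fin 3 → ℤ))
              (fun l : ↥(freqBall m : Finset (Fin 3 → ℤ)) => coeffExt (freqBall N : Finset (Fin 3 → ℤ)) x (l : Fin 3 → ℤ)))
            (coeffExt (freqBall m : Finset (Fin 3 → ℤ))
              (fun l : ↥(freqBall m : Finset (Fin 3 → ℤ)) => coeffExt (freqBall N : Finset (Fin 3 → ℤ)) x (l : Fin 3 → ℤ)))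
            (k : Fin 3 → ℤ) -
          convectionCoeff (freqBall N : Finset (Fin 3 → ℤ)) (coeffExt (freqBall N : Finset (Fin 3 → ℤ)) x)
            (coeffExt (freqBall N : Finset (Fin 3 → ℤ)) x) (k : Fin 3 → ℤ)) := by
    rw [coeffExt_of_mem _ hkN, galerkinRHS_apply, galerkinRHS_apply, galerkinField_def, galerkinField_def]
    simp only [coeffExt_coe, fourierRestrict_apply, coeffExt_of_mem _ hkN, leraySym_sub]
    abel
  rw [hdiff0]
  -- notation: the full family `xb`, its cut-off `yb` at level `m`, and the shell part `z`
  set xb : (Fin 3 → ℤ) → EuclideanSpace ℂ (Fin 3) := coeffExt (freqBall N : Finset (Fin 3 → ℤ)) x with hxb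
  set yb : (Fin 3 → ℤ) → EuclideanSpace ℂ (Fin 3) := coeffExt (freqBall m : Finset (Fin 3 → ℤ))
    (fun l : ↥(freqBall m : Finset (Fin 3 → ℤ)) => xb (l : Fin 3 → ℤ)) with hyb
  set z : (Fin 3 → ℤ) → EuclideanSpace ℂ (Fin 3) := xb - yb with hz
  -- values of yb and z
  have hyb_mem : ∀ j ∈ (freqBall m : Finset (Fin 3 → ℤ)), yb j = xb j := fun j hj => by
    rw [hyb, coeffExt_of_mem _ hj]
  have hyb_nmem : ∀ j ∉ (freqBall m : Finset (Fin 3 → ℤ)), yb j = 0 := fun j hj => by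
    rw [hyb, coeffExt_of_not_mem _ hj]
  have hz_mem : ∀ j ∈ (freqBall m : Finset (Fin 3 → ℤ)), z j = 0 := fun j hj => by
    rw [hz, Pi.sub_apply, hyb_mem j hj, sub_self]
  have hz_nmem : ∀ j ∉ (freqBall m : Finset (Fin 3 → ℤ)), z j = xb j := fun j hj => by
    rw [hz, Pi.sub_apply, hyb_nmem j hj, sub_zero]
  have hxb_le : ∀ j, ‖xb j‖ ≤ prof A θ j := norm_coeffExt_le_prof hA.le hθ.le x hx
  have hyb_le : ∀ j, ‖yb j‖ ≤ prof A θ j := fun j => by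
    by_cases hj : j ∈ (freqBall m : Finset (Fin 3 → ℤ))
    · rw [hyb_mem j hj]; exact hxb_le j
    · rw [hyb_nmem j hj, norm_zero]; exact prof_nonneg hA.le hθ.le j
  have hz_le : ∀ j, ‖z j‖ ≤ prof A θ j := fun j => by
    by_cases hj : j ∈ (freqBall m : Finset (Fin 3 → ℤ))
    · rw [hz_mem j hj, norm_zero]; exact prof_nonneg hA.le hθ.le j
    · rw [hz_nmem j hj]; exact hxb_le j
  -- tail membership gives the `m+1 ≤ |·|₁` floor
  have hfloor : ∀ j ∉ (freqBall m : Finset (Fin 3 → ℤ)), m + 1 ≤ l1 j := fun j hj =>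
    succ_le_l1_of_sq_lt (not_mem_freqBall.1 hj)
  have hk2m : l1 (k : Fin 3 → ℤ) ≤ 2 * m := l1_le_two_mul_of_sq_le (mem_freqBall.1 k.2)
  -- the cut-off family's convection symbol can be computed on the larger set
  rw [convectionCoeff_subset_eq hsub yb yb hyb_nmem hyb_nmem]
  refine (norm_leraySym_le _ _).trans ?_
  -- Step 2: bilinear splitting  B(xb,xb) - B(yb,yb) = B(z, xb) + B(yb, z)
  have hsplit : convectionCoeff (freqBall N : Finset (Fin 3 → ℤ)) xb xb (k : Fin 3 → ℤ) -
      convectionCoeff (freqBall N : Finset (Fin 3 → ℤ)) yb yb (k : Fin 3 → ℤ) =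
      convectionCoeff (freqBall N : Finset (Fin 3 → ℤ)) z xb (k : Fin 3 → ℤ) +
        convectionCoeff (freqBall N : Finset (Fin 3 → ℤ)) yb z (k : Fin 3 → ℤ) := by
    have exb : xb = yb + z := by rw [hz]; abel
    conv_lhs => rw [exb]
    rw [convectionCoeff_add_left, convectionCoeff_add_right, convectionCoeff_add_right]
    have : convectionCoeff (freqBall N : Finset (Fin 3 → ℤ)) z (yb + z) (k : Fin 3 → ℤ) =
        convectionCoeff (freqBall N : Finset (Fin 3 → ℤ)) z xb (k : Fin 3 → ℤ) := by rw [← exb]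
    rw [convectionCoeff_add_right] at this
    rw [← this]
    abel
  rw [norm_sub_rev, hsplit]
  refine (norm_add_le _ _).trans ?_
  -- Step 3: the two sums
  set ρ : ℕ := max (l1 (k : Fin 3 → ℤ)) m with hρ
  set P : ℝ := 1 + ((ρ : ℕ) : ℝ) with hP
  have hP0 : 0 < P := by rw [hP]; positivity
  have hC : 0 ≤ latC := latC_nonneg
  have hθρ : 0 ≤ θ ^ ρ := pow_nonneg hθ.le _
  -- (A): outside member k - l'
  have hA_sum : ∑ l' ∈ (freqBall N : Finset (Fin 3 → ℤ)), ‖z ((k : Fin 3 → ℤ) - l')‖ * ((l1 l' : ℕ) : ℝ) * ‖xb l'‖ ≤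
      3 * (A ^ 2 * θ ^ ρ) * (96 * latC * (P ^ 5)⁻¹) := by
    -- termwise against an indicator of the floor on k - l'
    have step : ∀ l' ∈ (freqBall N : Finset (Fin 3 → ℤ)),
        ‖z ((k : Fin 3 → ℤ) - l')‖ * ((l1 l' : ℕ) : ℝ) * ‖xb l'‖ ≤
          (if m + 1 ≤ l1 ((k : Fin 3 → ℤ) - l') then
            3 * (A ^ 2 * θ ^ ρ) * (((1 + ((l1 ((k : Fin 3 → ℤ) - l') : ℕ) : ℝ)) ^ 5)⁻¹ *
              ((1 + ((l1 l' : ℕ) : ℝ)) ^ 6)⁻¹) else 0) := by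
      intro l' _
      by_cases hj : ((k : Fin 3 → ℤ) - l') ∈ (freqBall m : Finset (Fin 3 → ℤ))
      · rw [hz_mem _ hj, norm_zero, zero_mul, zero_mul]
        split_ifs <;> positivity
      · rw [if_pos (hfloor _ hj)]
        calc ‖z ((k : Fin 3 → ℤ) - l')‖ * ((l1 l' : ℕ) : ℝ) * ‖xb l'‖
            ≤ prof A θ ((k : Fin 3 → ℤ) - l') * ((l1 l' : ℕ) : ℝ) * prof A θ l' := by
              have := hz_le ((k : Fin 3 → ℤ) - l'); have := hxb_le l'
              have : 0 ≤ prof A θ ((k : Fin 3 → ℤ) - l') := prof_nonneg hA.le hθ.le _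
              gcongr
          _ ≤ _ := by
              have := termA_le hA.le hθ.le hθ1 (k : Fin 3 → ℤ) l' hk2m (hfloor _ hj)
              simpa only [mul_assoc] using this
    refine (Finset.sum_le_sum step).trans ?_
    rw [← Finset.sum_filter]
    -- reindex l'' = k - l'
    have hinj : Set.InjOn (fun l' => (k : Fin 3 → ℤ) - l') ((freqBall N : Finset (Fin 3 → ℤ)).filter
        (fun l' => m + 1 ≤ l1 ((k : Fin 3 → ℤ) - l'))) := fun a _ b _ h => by simpa using h
    have himg : ((freqBall N : Finset (Fin 3 → ℤ)).filter (fun l' => m + 1 ≤ l1 ((k : Fin 3 → ℤ) - l'))).image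
        (fun l' => (k : Fin 3 → ℤ) - l') =
        (((freqBall N : Finset (Fin 3 → ℤ)).image (fun l' => (k : Fin 3 → ℤ) - l')).filter (fun j => m + 1 ≤ l1 j)) := by
      rw [Finset.filter_image]
    calc ∑ l' ∈ (freqBall N : Finset (Fin 3 → ℤ)).filter (fun l' => m + 1 ≤ l1 ((k : Fin 3 → ℤ) - l')),
          3 * (A ^ 2 * θ ^ ρ) * (((1 + ((l1 ((k : Fin 3 → ℤ) - l') : ℕ) : ℝ)) ^ 5)⁻¹ * ((1 + ((l1 l' : ℕ) : ℝ)) ^ 6)⁻¹)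
        = ∑ j ∈ (((freqBall N : Finset (Fin 3 → ℤ)).image (fun l' => (k : Fin 3 → ℤ) - l')).filter (fun j => m + 1 ≤ l1 j)),
          3 * (A ^ 2 * θ ^ ρ) * (((1 + ((l1 ((k : Fin 3 → ℤ) - j) : ℕ) : ℝ)) ^ 6)⁻¹ * ((1 + ((l1 j : ℕ) : ℝ)) ^ 5)⁻¹) := by
          rw [← himg, Finset.sum_image hinj]
          refine Finset.sum_congr rfl fun l' _ => ?_
          rw [sub_sub_cancel, mul_comm (((1 + ((l1 ((k : Fin 3 → ℤ) - l') : ℕ) : ℝ)) ^ 5)⁻¹)]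
      _ = 3 * (A ^ 2 * θ ^ ρ) * ∑ j ∈ (((freqBall N : Finset (Fin 3 → ℤ)).image (fun l' => (k : Fin 3 → ℤ) - l')).filter
            (fun j => m + 1 ≤ l1 j)),
          ((1 + ((l1 ((k : Fin 3 → ℤ) - j) : ℕ) : ℝ)) ^ 6)⁻¹ * ((1 + ((l1 j : ℕ) : ℝ)) ^ 5)⁻¹ := by rw [Finset.mul_sum]
      _ ≤ 3 * (A ^ 2 * θ ^ ρ) * (96 * latC * ((1 + ((max (l1 (k : Fin 3 → ℤ)) (m + 1) : ℕ) : ℝ)) ^ 5)⁻¹) :=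
          mul_le_mul_of_nonneg_left (keySum_le _ _ (m + 1)) (by positivity)
      _ ≤ 3 * (A ^ 2 * θ ^ ρ) * (96 * latC * (P ^ 5)⁻¹) := by
          gcongr
          rw [hP, hρ]
          have hmm : max (l1 (k : Fin 3 → ℤ)) m ≤ max (l1 (k : Fin 3 → ℤ)) (m + 1) := max_le_max le_rfl (Nat.le_succ m)
          have hmm' : ((max (l1 (k : Fin 3 → ℤ)) m : ℕ) : ℝ) ≤ ((max (l1 (k : Fin 3 → ℤ)) (m + 1) : ℕ) : ℝ) := by
            exact_mod_cast hmm
          linarith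
  -- (B): outside member l'
  have hB_sum : ∑ l' ∈ (freqBall N : Finset (Fin 3 → ℤ)), ‖yb ((k : Fin 3 → ℤ) - l')‖ * ((l1 l' : ℕ) : ℝ) * ‖z l'‖ ≤
      (A ^ 2 * θ ^ ρ) * (96 * latC * (P ^ 5)⁻¹) := by
    have step : ∀ l' ∈ (freqBall N : Finset (Fin 3 → ℤ)),
        ‖yb ((k : Fin 3 → ℤ) - l')‖ * ((l1 l' : ℕ) : ℝ) * ‖z l'‖ ≤
          (if m + 1 ≤ l1 l' then
            (A ^ 2 * θ ^ ρ) * (((1 + ((l1 ((k : Fin 3 → ℤ) - l') : ℕ) : ℝ)) ^ 6)⁻¹ * ((1 + ((l1 l' : ℕ) : ℝ)) ^ 5)⁻¹)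
          else 0) := by
      intro l' _
      by_cases hj : l' ∈ (freqBall m : Finset (Fin 3 → ℤ))
      · rw [hz_mem _ hj, norm_zero, mul_zero]
        split_ifs <;> positivity
      · rw [if_pos (hfloor _ hj)]
        calc ‖yb ((k : Fin 3 → ℤ) - l')‖ * ((l1 l' : ℕ) : ℝ) * ‖z l'‖
            ≤ prof A θ ((k : Fin 3 → ℤ) - l') * ((l1 l' : ℕ) : ℝ) * prof A θ l' := by
              have := hyb_le ((k : Fin 3 → ℤ) - l'); have := hz_le l'
              have : 0 ≤ prof A θ ((k : Fin 3 → ℤ) - l') := prof_nonneg hA.le hθ.le _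
              gcongr
          _ ≤ _ := termB_le hA.le hθ.le hθ1 (k : Fin 3 → ℤ) l' (hfloor _ hj)
    refine (Finset.sum_le_sum step).trans ?_
    rw [← Finset.sum_filter, ← Finset.mul_sum]
    refine (mul_le_mul_of_nonneg_left (keySum_le _ _ (m + 1)) (by positivity)).trans ?_
    gcongr
    rw [hP, hρ]
    have hmm : max (l1 (k : Fin 3 → ℤ)) m ≤ max (l1 (k : Fin 3 → ℤ)) (m + 1) := max_le_max le_rfl (Nat.le_succ m)
    have hmm' : ((max (l1 (k : Fin 3 → ℤ)) m : ℕ) : ℝ) ≤ ((max (l1 (k : Fin 3 → ℤ)) (m + 1) : ℕ) : ℝ) := by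
      exact_mod_cast hmm
    linarith
  -- Step 4: combine with the convection-norm lemma and the threshold
  have hnA := norm_convectionCoeff_le (freqBall N : Finset (Fin 3 → ℤ)) z xb (k : Fin 3 → ℤ)
  have hnB := norm_convectionCoeff_le (freqBall N : Finset (Fin 3 → ℤ)) yb z (k : Fin 3 → ℤ)
  have hpi : 0 < Real.pi := Real.pi_pos
  have htot : ‖convectionCoeff (freqBall N : Finset (Fin 3 → ℤ)) z xb (k : Fin 3 → ℤ)‖ +
      ‖convectionCoeff (freqBall N : Finset (Fin 3 → ℤ)) yb z (k : Fin 3 → ℤ)‖ ≤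
      768 * Real.pi * latC * (A ^ 2 * θ ^ ρ * (P ^ 5)⁻¹) := by
    have h1 := mul_le_mul_of_nonneg_left hA_sum (by positivity : (0 : ℝ) ≤ 2 * Real.pi)
    have h2 := mul_le_mul_of_nonneg_left hB_sum (by positivity : (0 : ℝ) ≤ 2 * Real.pi)
    have e : 2 * Real.pi * (3 * (A ^ 2 * θ ^ ρ) * (96 * latC * (P ^ 5)⁻¹)) +
        2 * Real.pi * ((A ^ 2 * θ ^ ρ) * (96 * latC * (P ^ 5)⁻¹)) = 768 * Real.pi * latC * (A ^ 2 * θ ^ ρ * (P ^ 5)⁻¹) := by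
      ring
    linarith
  refine htot.trans ?_
  -- 768 π C A² θ^ρ P^{-5} ≤ ν A θ^ρ P^{-4}  ⟸  768 π C A ≤ ν P
  rw [cpl_eq, ← hρ, ← hP]
  have hPm : (m : ℝ) + 1 ≤ P := by
    rw [hP, hρ]
    have : (m : ℝ) ≤ ((max (l1 (k : Fin 3 → ℤ)) m : ℕ) : ℝ) := by exact_mod_cast le_max_right _ _
    linarith
  have hth' : 768 * Real.pi * latC * A ≤ ν * P := hth.trans (mul_le_mul_of_nonneg_left hPm hν.le)
  rw [div_eq_mul_inv]
  have e4 : (P ^ 4)⁻¹ = P * (P ^ 5)⁻¹ := by field_simp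
  rw [e4]
  calc 768 * Real.pi * latC * (A ^ 2 * θ ^ ρ * (P ^ 5)⁻¹)
      = (768 * Real.pi * latC * A) * (A * θ ^ ρ * (P ^ 5)⁻¹) := by ring
    _ ≤ (ν * P) * (A * θ ^ ρ * (P ^ 5)⁻¹) := mul_le_mul_of_nonneg_right hth' (by positivity)
    _ = ν * A * θ ^ ρ * (P * (P ^ 5)⁻¹) := by ring

/-! ## §8 The piece `UniformTailEstimates` (verbatim), with the sweeping scale `M = max M₀ (max M₁ M₂)` -/

/-- **Piece P2 `UniformTailEstimates` of the tail-lift split — PROVED** (registered stub `stub_uniformTailEstimates` of line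
`TailLift`, crux stmt-AnomalousDissipation-10352; the statement is verbatim the second hypothesis of
`TailLiftSplit.uniformGalerkinTrap_of_tailLift`).  Thresholds: `M₀ > 288 C A/(π ν)` (entrance), `M₁ ≥ 768 π C A/ν`
(coupling), `(θ²)^{M₂} < δ / ((4π²+1)(A² C + 1))` (tail sums), `C = latC = (∑_{n∈ℤ}(1+|n|)^{-2})³`. -/
theorem uniformTailEstimates_proof :
    ∀ ν A θ δ : ℝ, 0 < ν → 0 < A → 0 < θ → θ < 1 → 0 < δ → ∃ M : ℕ, ∀ m N : ℕ, M ≤ m → m ≤ N →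
      ∀ x : ↥(freqBall N : Finset (Fin 3 → ℤ)) → EuclideanSpace ℂ (Fin 3),
        (∀ k : ↥(freqBall N : Finset (Fin 3 → ℤ)), ‖x k‖ ≤ A * θ ^ (∑ i, ((k : Fin 3 → ℤ) i).natAbs) / (1 + ∑ i, (((k : Fin 3 → ℤ) i).natAbs : ℝ)) ^ 6) →
        (∀ (g : ↥(freqBall N : Finset (Fin 3 → ℤ)) → EuclideanSpace ℂ (Fin 3)) (k : ↥(freqBall N : Finset (Fin 3 → ℤ))),
            ((m : ℕ) : ℝ) ^ 2 < freqNormSq (k : Fin 3 → ℤ) → g k = 0 →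
            ‖x k‖ = A * θ ^ (∑ i, ((k : Fin 3 → ℤ) i).natAbs) / (1 + ∑ i, (((k : Fin 3 → ℤ) i).natAbs : ℝ)) ^ 6 →
            (inner ℂ (x k) (galerkinRHS (freqBall N : Finset (Fin 3 → ℤ)) ν g x k)).re < 0) ∧
        (∀ (f : UnitAddTorus (Fin 3) → EuclideanSpace ℝ (Fin 3)) (k : ↥(freqBall m : Finset (Fin 3 → ℤ))),
            ‖coeffExt (freqBall N : Finset (Fin 3 → ℤ)) (galerkinRHS (freqBall N : Finset (Fin 3 → ℤ)) ν (fourierRestrict (freqBall N : Finset (Fin 3 → ℤ)) f) x) (k : Fin 3 → ℤ) -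
                galerkinRHS (freqBall m : Finset (Fin 3 → ℤ)) ν (fourierRestrict (freqBall m : Finset (Fin 3 → ℤ)) f)
                  (fun l : ↥(freqBall m : Finset (Fin 3 → ℤ)) => coeffExt (freqBall N : Finset (Fin 3 → ℤ)) x (l : Fin 3 → ℤ)) k‖ ≤
              ν * A * θ ^ (max (∑ j, ((k : Fin 3 → ℤ) j).natAbs) m) / (1 + ((max (∑ j, ((k : Fin 3 → ℤ) j).natAbs) m : ℕ) : ℝ)) ^ 4) ∧
        2⁻¹ * ∑ k : ↥(freqBall N : Finset (Fin 3 → ℤ)), ‖x k‖ ^ 2 ≤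
          2⁻¹ * ∑ l : ↥(freqBall m : Finset (Fin 3 → ℤ)), ‖coeffExt (freqBall N : Finset (Fin 3 → ℤ)) x (l : Fin 3 → ℤ)‖ ^ 2 + δ ∧
        4 * Real.pi ^ 2 * ∑ k : ↥(freqBall N : Finset (Fin 3 → ℤ)), freqNormSq (k : Fin 3 → ℤ) * ‖x k‖ ^ 2 ≤
          4 * Real.pi ^ 2 * ∑ l : ↥(freqBall m : Finset (Fin 3 → ℤ)),
            freqNormSq (l : Fin 3 → ℤ) * ‖coeffExt (freqBall N : Finset (Fin 3 → ℤ)) x (l : Fin 3 → ℤ)‖ ^ 2 + δ := by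
  intro ν A θ δ hν hA hθ hθ1 hδ
  have hC : 0 ≤ latC := latC_nonneg
  have hpi : 0 < Real.pi := Real.pi_pos
  obtain ⟨M₀, hM₀⟩ : ∃ M₀ : ℕ, 288 * latC * A / (Real.pi * ν) < M₀ := exists_nat_gt _
  obtain ⟨M₁, hM₁⟩ : ∃ M₁ : ℕ, 768 * Real.pi * latC * A / ν ≤ M₁ := exists_nat_ge _
  have hθ2 : θ ^ 2 < 1 := pow_lt_one₀ hθ.le hθ1 two_ne_zero
  obtain ⟨M₂, hM₂⟩ : ∃ M₂ : ℕ, (θ ^ 2) ^ M₂ < δ / ((4 * Real.pi ^ 2 + 1) * (A ^ 2 * latC + 1)) :=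
    exists_pow_lt_of_lt_one (by positivity) hθ2
  refine ⟨max M₀ (max M₁ M₂), fun m N hMm hmN x hx => ⟨?_, ?_, ?_⟩⟩
  · -- (i) per-mode tail entrance
    intro g k hk hg hnorm
    have hm0 : (M₀ : ℝ) ≤ m := by exact_mod_cast (le_max_left _ _).trans hMm
    have e : 288 * latC * A < (M₀ : ℝ) * (Real.pi * ν) := (div_lt_iff₀ (by positivity)).1 hM₀
    have e2 : (M₀ : ℝ) * (Real.pi * ν) ≤ (m : ℝ) * (Real.pi * ν) := mul_le_mul_of_nonneg_right hm0 (by positivity)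
    have e3 : Real.pi * ν * ((m : ℝ) + 1) = (m : ℝ) * (Real.pi * ν) + Real.pi * ν := by ring
    have hth : 288 * latC * A < Real.pi * ν * ((m : ℝ) + 1) := by
      rw [e3]; nlinarith [mul_pos hpi hν]
    exact entrance_clause hν hA hθ hθ1.le hth x g hx k hk hg hnorm
  · -- (ii) modewise coupling
    intro f k
    have hm1 : (M₁ : ℝ) ≤ m := by exact_mod_cast ((le_max_left _ _).trans (le_max_right _ _)).trans hMm
    have e : 768 * Real.pi * latC * A ≤ (M₁ : ℝ) * ν := (div_le_iff₀ hν).1 hM₁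
    have e2 : (M₁ : ℝ) * ν ≤ (m : ℝ) * ν := mul_le_mul_of_nonneg_right hm1 hν.le
    have e3 : ν * ((m : ℝ) + 1) = (m : ℝ) * ν + ν := by ring
    have hth : 768 * Real.pi * latC * A ≤ ν * ((m : ℝ) + 1) := by rw [e3]; linarith
    exact coupling_clause hν hA hθ hθ1.le hmN hth x hx f k
  · -- (iii)/(iv) tail energy and enstrophy
    have hm2 : M₂ ≤ m := ((le_max_right _ _).trans (le_max_right _ _)).trans hMm
    have hθm : θ ^ (2 * m) ≤ (θ ^ 2) ^ M₂ := by
      rw [pow_mul]; exact pow_le_pow_of_le_one (by positivity) hθ2.le hm2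
    have h1 : A ^ 2 * θ ^ (2 * m) * latC ≤ (A ^ 2 * latC + 1) * θ ^ (2 * m) := by
      nlinarith [pow_nonneg hθ.le (2 * m), mul_nonneg (sq_nonneg A) hC]
    have h2 : (A ^ 2 * latC + 1) * θ ^ (2 * m) ≤ (A ^ 2 * latC + 1) * (δ / ((4 * Real.pi ^ 2 + 1) * (A ^ 2 * latC + 1))) :=
      mul_le_mul_of_nonneg_left (hθm.trans hM₂.le) (by positivity)
    have h3 : (A ^ 2 * latC + 1) * (δ / ((4 * Real.pi ^ 2 + 1) * (A ^ 2 * latC + 1))) = δ / (4 * Real.pi ^ 2 + 1) := by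
      field_simp
    have hsmall : A ^ 2 * θ ^ (2 * m) * latC ≤ δ / (4 * Real.pi ^ 2 + 1) := by linarith
    have hfrac : δ / (4 * Real.pi ^ 2 + 1) ≤ δ := div_le_self hδ.le (by nlinarith)
    have hfrac2 : 4 * Real.pi ^ 2 * (δ / (4 * Real.pi ^ 2 + 1)) ≤ δ := by
      rw [mul_div_assoc', div_le_iff₀ (by positivity)]; nlinarith
    obtain ⟨tE, tZ⟩ := tail_sums_le hA.le hθ.le hθ1.le hmN x hx
    constructor
    · have : 2⁻¹ * (A ^ 2 * θ ^ (2 * m) * latC) ≤ δ := by linarith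
      linarith
    · have : 4 * Real.pi ^ 2 * (A ^ 2 * θ ^ (2 * m) * latC) ≤ δ :=
        (mul_le_mul_of_nonneg_left hsmall (by positivity)).trans hfrac2
      linarith


end Summit.AnomalousDissipation.AnomalousDissipation.Cruxes.UniformGalerkinTrap.TailLift.P2

/-! # §STUBS — line `TailLift`: the two registered stubs (P1 open; P2 proved by PART I) -/

namespace Summit.AnomalousDissipation.AnomalousDissipation.Cruxes.UniformGalerkinTrap.TailLift

open scoped InnerProductSpace ENNReal NNReal
open MeasureTheory Set Filter Topology
open Literature.Analysis.FunctionSpaces Literature.Analysis.FunctionSpaces.Torus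
open Literature.Analysis.FluidPDE

/-- **stub P1 (THE BET, `RobustLoudLowBlocks`)** — the only open statement of the line. -/
theorem stub_robustLoudLowBlocks :
    ∃ (mf : ℕ) (f : UnitAddTorus (Fin 3) → EuclideanSpace ℝ (Fin 3)),
      ((IsSmooth f ∧ IsDivFree f ∧ ∀ k : Fin 3 → ℤ, ((mf : ℕ) : ℝ) ^ 2 < freqNormSq k →
          UnitAddTorus.mFourierCoeff (EuclideanSpace.complexify ∘ f) k = 0) ∧ HasZeroMean f) ∧
      ∃ (E ε₀ ν₀ : ℝ), 0 < ε₀ ∧ 0 < ν₀ ∧ ∀ ν : ℝ, 0 < ν → ν ≤ ν₀ →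
        ∃ (A θ δ : ℝ) (G : ℝ≥0), 0 < A ∧ 0 < θ ∧ θ < 1 ∧ 0 < δ ∧ ∀ M : ℕ, ∃ m : ℕ, M ≤ m ∧ mf ≤ m ∧
          ∃ (n : ℕ) (h : Fin n → (↥(freqBall m : Finset (Fin 3 → ℤ)) → EuclideanSpace ℂ (Fin 3)) → ℝ)
            (h' : Fin n → (↥(freqBall m : Finset (Fin 3 → ℤ)) → EuclideanSpace ℂ (Fin 3)) →
              ((↥(freqBall m : Finset (Fin 3 → ℤ)) → EuclideanSpace ℂ (Fin 3)) →L[ℝ] ℝ)),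
            (∀ i y, HasFDerivAt (h i) (h' i y) y) ∧ (∀ i, Continuous (h' i)) ∧
            (∀ y : ↥(galerkinSubspace (freqBall m : Finset (Fin 3 → ℤ))),
                (∀ i, 0 ≤ h i y) → (∀ k : ↥(freqBall m : Finset (Fin 3 → ℤ)), (k : Fin 3 → ℤ) = 0 →
                  (y : ↥(freqBall m : Finset (Fin 3 → ℤ)) → EuclideanSpace ℂ (Fin 3)) k = 0) →
                ∀ i, h i y = 0 → ∀ w : ↥(freqBall m : Finset (Fin 3 → ℤ)) → EuclideanSpace ℂ (Fin 3),
                  (∀ k : ↥(freqBall m : Finset (Fin 3 → ℤ)), ‖w k‖ ≤ ν * A * θ ^ (max (∑ j, ((k : Fin 3 → ℤ) j).natAbs) m) /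
                    (1 + ((max (∑ j, ((k : Fin 3 → ℤ) j).natAbs) m : ℕ) : ℝ)) ^ 4) →
                  h' i y (galerkinRHS (freqBall m : Finset (Fin 3 → ℤ)) ν (fourierRestrict (freqBall m : Finset (Fin 3 → ℤ)) f) y + w) ≠ 0) ∧
            (¬ ∃ r : ↥(galerkinSubspace (freqBall m : Finset (Fin 3 → ℤ))) → ↥(galerkinSubspace (freqBall m : Finset (Fin 3 → ℤ))),
                ContinuousOn r {y | (∀ i, 0 ≤ h i y) ∧ ∀ k : ↥(freqBall m : Finset (Fin 3 → ℤ)), (k : Fin 3 → ℤ) = 0 →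
                  (y : ↥(freqBall m : Finset (Fin 3 → ℤ)) → EuclideanSpace ℂ (Fin 3)) k = 0} ∧
                MapsTo r {y | (∀ i, 0 ≤ h i y) ∧ ∀ k : ↥(freqBall m : Finset (Fin 3 → ℤ)), (k : Fin 3 → ℤ) = 0 →
                  (y : ↥(freqBall m : Finset (Fin 3 → ℤ)) → EuclideanSpace ℂ (Fin 3)) k = 0}
                  {y | ((∀ i, 0 ≤ h i y) ∧ ∀ k : ↥(freqBall m : Finset (Fin 3 → ℤ)), (k : Fin 3 → ℤ) = 0 →
                    (y : ↥(freqBall m : Finset (Fin 3 → ℤ)) → EuclideanSpace ℂ (Fin 3)) k = 0) ∧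
                    ∃ i, h i y = 0 ∧ h' i y (galerkinRHS (freqBall m : Finset (Fin 3 → ℤ)) ν (fourierRestrict (freqBall m : Finset (Fin 3 → ℤ)) f) y) < 0} ∧
                ∀ y ∈ {y : ↥(galerkinSubspace (freqBall m : Finset (Fin 3 → ℤ))) | ((∀ i, 0 ≤ h i y) ∧ ∀ k : ↥(freqBall m : Finset (Fin 3 → ℤ)), (k : Fin 3 → ℤ) = 0 →
                    (y : ↥(freqBall m : Finset (Fin 3 → ℤ)) → EuclideanSpace ℂ (Fin 3)) k = 0) ∧
                    ∃ i, h i y = 0 ∧ h' i y (galerkinRHS (freqBall m : Finset (Fin 3 → ℤ)) ν (fourierRestrict (freqBall m : Finset (Fin 3 → ℤ)) f) y) < 0},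
                  r y = y) ∧
            (∀ y : ↥(galerkinSubspace (freqBall m : Finset (Fin 3 → ℤ))),
                (∀ i, 0 ≤ h i y) → (∀ k : ↥(freqBall m : Finset (Fin 3 → ℤ)), (k : Fin 3 → ℤ) = 0 →
                  (y : ↥(freqBall m : Finset (Fin 3 → ℤ)) → EuclideanSpace ℂ (Fin 3)) k = 0) →
                (∀ k : ↥(freqBall m : Finset (Fin 3 → ℤ)), ‖(y : ↥(freqBall m : Finset (Fin 3 → ℤ)) → EuclideanSpace ℂ (Fin 3)) k‖ ≤
                    A * θ ^ (∑ i, ((k : Fin 3 → ℤ) i).natAbs) / (1 + ∑ i, (((k : Fin 3 → ℤ) i).natAbs : ℝ)) ^ 6) ∧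
                2⁻¹ * ∑ k, ‖(y : ↥(freqBall m : Finset (Fin 3 → ℤ)) → EuclideanSpace ℂ (Fin 3)) k‖ ^ 2 + δ ≤ E ∧
                ε₀ ≤ ∑ k, (inner ℂ (fourierRestrict (freqBall m : Finset (Fin 3 → ℤ)) f k)
                  ((y : ↥(freqBall m : Finset (Fin 3 → ℤ)) → EuclideanSpace ℂ (Fin 3)) k)).re ∧
                4 * Real.pi ^ 2 * ∑ k, freqNormSq ((k : ↥(freqBall m : Finset (Fin 3 → ℤ))) : Fin 3 → ℤ) *
                  ‖(y : ↥(freqBall m : Finset (Fin 3 → ℤ)) → EuclideanSpace ℂ (Fin 3)) k‖ ^ 2 + δ ≤ (G : ℝ)) := by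
  sorry

/-- **stub P2 (`UniformTailEstimates`)** — PROVED (PART I). -/
theorem stub_uniformTailEstimates :
    ∀ ν A θ δ : ℝ, 0 < ν → 0 < A → 0 < θ → θ < 1 → 0 < δ → ∃ M : ℕ, ∀ m N : ℕ, M ≤ m → m ≤ N →
      ∀ x : ↥(freqBall N : Finset (Fin 3 → ℤ)) → EuclideanSpace ℂ (Fin 3),
        (∀ k : ↥(freqBall N : Finset (Fin 3 → ℤ)), ‖x k‖ ≤ A * θ ^ (∑ i, ((k : Fin 3 → ℤ) i).natAbs) / (1 + ∑ i, (((k : Fin 3 → ℤ) i).natAbs : ℝ)) ^ 6) →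
        (∀ (g : ↥(freqBall N : Finset (Fin 3 → ℤ)) → EuclideanSpace ℂ (Fin 3)) (k : ↥(freqBall N : Finset (Fin 3 → ℤ))),
            ((m : ℕ) : ℝ) ^ 2 < freqNormSq (k : Fin 3 → ℤ) → g k = 0 →
            ‖x k‖ = A * θ ^ (∑ i, ((k : Fin 3 → ℤ) i).natAbs) / (1 + ∑ i, (((k : Fin 3 → ℤ) i).natAbs : ℝ)) ^ 6 →
            (inner ℂ (x k) (galerkinRHS (freqBall N : Finset (Fin 3 → ℤ)) ν g x k)).re < 0) ∧
        (∀ (f : UnitAddTorus (Fin 3) → EuclideanSpace ℝ (Fin 3)) (k : ↥(freqBall m : Finset (Fin 3 → ℤ))),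
            ‖coeffExt (freqBall N : Finset (Fin 3 → ℤ)) (galerkinRHS (freqBall N : Finset (Fin 3 → ℤ)) ν (fourierRestrict (freqBall N : Finset (Fin 3 → ℤ)) f) x) (k : Fin 3 → ℤ) -
                galerkinRHS (freqBall m : Finset (Fin 3 → ℤ)) ν (fourierRestrict (freqBall m : Finset (Fin 3 → ℤ)) f)
                  (fun l : ↥(freqBall m : Finset (Fin 3 → ℤ)) => coeffExt (freqBall N : Finset (Fin 3 → ℤ)) x (l : Fin 3 → ℤ)) k‖ ≤
              ν * A * θ ^ (max (∑ j, ((k : Fin 3 → ℤ) j).natAbs) m) / (1 + ((max (∑ j, ((k : Fin 3 → ℤ) j).natAbs) m : ℕ) : ℝ)) ^ 4) ∧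
        2⁻¹ * ∑ k : ↥(freqBall N : Finset (Fin 3 → ℤ)), ‖x k‖ ^ 2 ≤
          2⁻¹ * ∑ l : ↥(freqBall m : Finset (Fin 3 → ℤ)), ‖coeffExt (freqBall N : Finset (Fin 3 → ℤ)) x (l : Fin 3 → ℤ)‖ ^ 2 + δ ∧
        4 * Real.pi ^ 2 * ∑ k : ↥(freqBall N : Finset (Fin 3 → ℤ)), freqNormSq (k : Fin 3 → ℤ) * ‖x k‖ ^ 2 ≤
          4 * Real.pi ^ 2 * ∑ l : ↥(freqBall m : Finset (Fin 3 → ℤ)),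
            freqNormSq (l : Fin 3 → ℤ) * ‖coeffExt (freqBall N : Finset (Fin 3 → ℤ)) x (l : Fin 3 → ℤ)‖ ^ 2 + δ :=
  P2.uniformTailEstimates_proof

end Summit.AnomalousDissipation.AnomalousDissipation.Cruxes.UniformGalerkinTrap.TailLift

/-! # PART II — the tail-lift assembly, ending in the composition `UniformGalerkinTrap_of` -/

namespace Summit.AnomalousDissipation.AnomalousDissipation.Cruxes.UniformGalerkinTrap.TailLift

open scoped InnerProductSpace ENNReal NNReal
open MeasureTheory Set Filter Topology
open Literature.Analysis.FunctionSpaces Literature.Analysis.FunctionSpaces.Torus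
open Literature.Analysis.FluidPDE
open Literature.Dynamics.ConleyIndex

/-! ## §0 Abbreviations -/

/-- Coefficient vectors of order `n` (the ambient real normed space of the phase space). -/
abbrev Coef (n : ℕ) : Type := ↥(freqBall n : Finset (Fin 3 → ℤ)) → EuclideanSpace ℂ (Fin 3)

/-- The Galerkin phase space of order `n` (real divergence-free coefficient vectors). -/
abbrev Phase (n : ℕ) : Type := ↥(galerkinSubspace (freqBall n : Finset (Fin 3 → ℤ)))

/-! ## §1 Two elementary lemmas -/

/-- **Sign constancy of an affine function without zeros on `[0,1]`.** [folklore] -/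
theorem neg_iff_neg_of_forall_add_mul_ne_zero {a b : ℝ} (h : ∀ s ∈ Set.Icc (0 : ℝ) 1, a + s * b ≠ 0) :
    (a + b < 0 ↔ a < 0) := by
  have ha : a ≠ 0 := by simpa using h 0 ⟨le_rfl, zero_le_one⟩
  have hab : a + b ≠ 0 := by simpa using h 1 ⟨zero_le_one, le_rfl⟩
  constructor
  · intro hlt
    by_contra hge
    have ha' : 0 < a := lt_of_le_of_ne (not_lt.1 hge) (Ne.symm ha)
    have hb : 0 < -b := by linarith
    have hs0 : 0 ≤ a / (-b) := div_nonneg ha'.le hb.le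
    have hs1 : a / (-b) ≤ 1 := by rw [div_le_one hb]; linarith
    refine h (a / (-b)) ⟨hs0, hs1⟩ ?_
    have hb0 : b ≠ 0 := by linarith
    field_simp
    ring
  · intro hlt
    by_contra hge
    have hab' : 0 < a + b := lt_of_le_of_ne (not_lt.1 hge) (Ne.symm hab)
    have hb : 0 < b := by linarith
    have hs0 : 0 ≤ (-a) / b := div_nonneg (by linarith) hb.le
    have hs1 : (-a) / b ≤ 1 := by rw [div_le_one hb]; linarith
    refine h ((-a) / b) ⟨hs0, hs1⟩ ?_
    have hb0 : b ≠ 0 := by linarith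
    field_simp
    ring

/-- **Retractions descend along a section.** If `ι : Y → X` has the continuous left inverse `P`, maps
`B` into `B'` and `E` into `E'`, and `P` maps `E'` into `E`, then a retraction of `B'` onto `E'` yields a
retraction `P ∘ r ∘ ι` of `B` onto `E`; contrapositive form. [folklore] -/
theorem not_retract_of_section {X Y : Type*} [TopologicalSpace X] [TopologicalSpace Y]
    {B E : Set Y} {B' E' : Set X} (ι : Y → X) (P : X → Y) (hι : Continuous ι) (hP : Continuous P)
    (hPι : ∀ y, P (ι y) = y) (hιB : MapsTo ι B B') (hιE : MapsTo ι E E') (hPE : MapsTo P E' E)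
    (h : ¬ ∃ r : Y → Y, ContinuousOn r B ∧ MapsTo r B E ∧ ∀ y ∈ E, r y = y) :
    ¬ ∃ r : X → X, ContinuousOn r B' ∧ MapsTo r B' E' ∧ ∀ x ∈ E', r x = x := by
  rintro ⟨r, hr, hrm, hfix⟩
  refine h ⟨fun y => P (r (ι y)), ?_, fun y hy => hPE (hrm (hιB hy)), fun y hy => ?_⟩
  · exact hP.comp_continuousOn (hr.comp hι.continuousOn hιB)
  · simp only
    rw [hfix _ (hιE hy), hPι]

/-! ## §2 Relabelling coefficient vectors between levels -/

/-- Relabel a coefficient vector on `S` as one on `T` (restriction on `S ∩ T`, zero on `T \ S`): the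
restriction `P` when `T ⊆ S` and the extension by zero `ι` when `S ⊆ T`. -/
def relabel (S T : Finset (Fin 3 → ℤ)) (v : ↥S → EuclideanSpace ℂ (Fin 3)) : ↥T → EuclideanSpace ℂ (Fin 3) :=
  fun k => coeffExt S v (k : Fin 3 → ℤ)

theorem relabel_apply (S T : Finset (Fin 3 → ℤ)) (v : ↥S → EuclideanSpace ℂ (Fin 3)) (k : ↥T) :
    relabel S T v k = coeffExt S v (k : Fin 3 → ℤ) := rfl

theorem relabel_apply_of_mem {S T : Finset (Fin 3 → ℤ)} (v : ↥S → EuclideanSpace ℂ (Fin 3)) {k : ↥T}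
    (hk : (k : Fin 3 → ℤ) ∈ S) : relabel S T v k = v ⟨k, hk⟩ :=
  coeffExt_of_mem v hk

theorem relabel_apply_of_not_mem {S T : Finset (Fin 3 → ℤ)} (v : ↥S → EuclideanSpace ℂ (Fin 3)) {k : ↥T}
    (hk : (k : Fin 3 → ℤ) ∉ S) : relabel S T v k = 0 :=
  coeffExt_of_not_mem v hk

/-- Round trip: extend from `S` to `T ⊇ S`, then restrict back. -/
theorem relabel_relabel_of_subset {S T : Finset (Fin 3 → ℤ)} (hST : S ⊆ T) (v : ↥S → EuclideanSpace ℂ (Fin 3)) :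
    relabel T S (relabel S T v) = v := by
  funext k
  rw [relabel_apply_of_mem _ (hST k.2),
    relabel_apply_of_mem (k := (⟨(k : Fin 3 → ℤ), hST k.2⟩ : ↥T)) v k.2]

/-- `coeffExt` of a relabelled vector agrees with the original `coeffExt` on `T`. -/
theorem coeffExt_relabel_of_mem {S T : Finset (Fin 3 → ℤ)} (v : ↥S → EuclideanSpace ℂ (Fin 3)) {k : Fin 3 → ℤ}
    (hk : k ∈ T) : coeffExt T (relabel S T v) k = coeffExt S v k := by
  rw [coeffExt_of_mem _ hk]; rfl

/-- Relabelling as a real linear map. -/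
def relabelₗ (S T : Finset (Fin 3 → ℤ)) : (↥S → EuclideanSpace ℂ (Fin 3)) →ₗ[ℝ] (↥T → EuclideanSpace ℂ (Fin 3)) where
  toFun := relabel S T
  map_add' v w := by funext k; simp [relabel, coeffExt_add]
  map_smul' a v := by funext k; simp [relabel, coeffExt_smul]

/-- Relabelling as a continuous real linear map (finite dimensions). -/
def relabelL (S T : Finset (Fin 3 → ℤ)) : (↥S → EuclideanSpace ℂ (Fin 3)) →L[ℝ] (↥T → EuclideanSpace ℂ (Fin 3)) :=
  LinearMap.toContinuousLinearMap (relabelₗ S T)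

@[simp] theorem relabelL_apply (S T : Finset (Fin 3 → ℤ)) (v : ↥S → EuclideanSpace ℂ (Fin 3)) :
    relabelL S T v = relabel S T v := rfl

theorem continuous_relabel (S T : Finset (Fin 3 → ℤ)) : Continuous (relabel S T) :=
  (relabelL S T).continuous

theorem hasFDerivAt_relabel (S T : Finset (Fin 3 → ℤ)) (v : ↥S → EuclideanSpace ℂ (Fin 3)) :
    HasFDerivAt (relabel S T) (relabelL S T) v :=
  (relabelL S T).hasFDerivAt

/-- Relabelled phase vectors are phase vectors (reality and transversality are modewise). -/
theorem relabel_mem_galerkinSubspace {S T : Finset (Fin 3 → ℤ)} (hS : ∀ k ∈ S, -k ∈ S)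
    {v : ↥S → EuclideanSpace ℂ (Fin 3)} (hv : v ∈ galerkinSubspace S) :
    relabel S T v ∈ galerkinSubspace T := by
  refine ⟨isRealCoeff_restrict (hv.1.isConjSymm_coeffExt hS), fun k => ?_⟩
  show ∑ j, ((k : Fin 3 → ℤ) j : ℂ) * coeffExt S v (k : Fin 3 → ℤ) j = 0
  by_cases hk : (k : Fin 3 → ℤ) ∈ S
  · rw [coeffExt_of_mem v hk]
    exact hv.2 ⟨k, hk⟩
  · simp [coeffExt_of_not_mem v hk]

/-- Relabelling on phase spaces. -/
def relabelPhase {S : Finset (Fin 3 → ℤ)} (hS : ∀ k ∈ S, -k ∈ S) (T : Finset (Fin 3 → ℤ))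
    (x : ↥(galerkinSubspace S)) : ↥(galerkinSubspace T) :=
  ⟨relabel S T x, relabel_mem_galerkinSubspace hS x.2⟩

@[simp] theorem coe_relabelPhase {S : Finset (Fin 3 → ℤ)} (hS : ∀ k ∈ S, -k ∈ S) (T : Finset (Fin 3 → ℤ))
    (x : ↥(galerkinSubspace S)) :
    ((relabelPhase hS T x : ↥(galerkinSubspace T)) : ↥T → EuclideanSpace ℂ (Fin 3)) = relabel S T x := rfl

theorem continuous_relabelPhase {S : Finset (Fin 3 → ℤ)} (hS : ∀ k ∈ S, -k ∈ S) (T : Finset (Fin 3 → ℤ)) :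
    Continuous (relabelPhase hS T) :=
  ((continuous_relabel S T).comp continuous_subtype_val).subtype_mk _

/-! ## §3 Splitting sums over `freqBall N` into the low ball `freqBall m` and the tail -/

theorem filter_freqBall_le {m N : ℕ} (hmN : m ≤ N) :
    (freqBall N : Finset (Fin 3 → ℤ)).filter (fun k => freqNormSq k ≤ ((m : ℕ) : ℝ) ^ 2) = freqBall m := by
  ext k
  simp only [Finset.mem_filter, mem_freqBall]
  constructor
  · exact fun hk => hk.2
  · intro hk
    exact ⟨hk.trans (by gcongr), hk⟩

/-- `∑_{|k| ≤ N} g = ∑_{|k| ≤ m} g + ∑_{|k| ≤ N} 𝟙{m² < |k|²} g` for `m ≤ N`. [folklore] -/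
theorem sum_freqBall_split {m N : ℕ} (hmN : m ≤ N) (g : (Fin 3 → ℤ) → ℝ) :
    ∑ k : ↥(freqBall N : Finset (Fin 3 → ℤ)), g k =
      ∑ l : ↥(freqBall m : Finset (Fin 3 → ℤ)), g l +
        ∑ k : ↥(freqBall N : Finset (Fin 3 → ℤ)), (if ((m : ℕ) : ℝ) ^ 2 < freqNormSq (k : Fin 3 → ℤ) then g k else 0) := by
  rw [Finset.sum_coe_sort (freqBall N) g, Finset.sum_coe_sort (freqBall m) g,
    Finset.sum_coe_sort (freqBall N) (fun k => if ((m : ℕ) : ℝ) ^ 2 < freqNormSq k then g k else 0),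
    ← Finset.sum_filter, ← filter_freqBall_le hmN,
    ← Finset.sum_filter_add_sum_filter_not (freqBall N) (fun k => freqNormSq k ≤ ((m : ℕ) : ℝ) ^ 2) g]
  congr 1
  refine Finset.sum_congr ?_ fun _ _ => rfl
  ext k
  simp only [Finset.mem_filter, not_le]


/-! ## §4 The lifted block data at level `N` -/

section Lift

/-- The Gevrey-type profile `A θ^{|k|₁} (1 + |k|₁)^{-6}` shared by the two pieces. -/
def prof (A θ : ℝ) (k : Fin 3 → ℤ) : ℝ :=
  A * θ ^ (∑ i, (k i).natAbs) / (1 + ∑ i, ((k i).natAbs : ℝ)) ^ 6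

theorem prof_pos {A θ : ℝ} (hA : 0 < A) (hθ : 0 < θ) (k : Fin 3 → ℤ) : 0 < prof A θ k := by
  unfold prof
  positivity

/-- The modewise TAIL-COUPLING MAJORANT `ν A θ^{max(|k|₁,m)} (1 + max(|k|₁,m))^{-4}` shared by the two
pieces: the low-block piece is robust against perturbations below it, the tail piece proves the actual
low/tail coupling of the Galerkin field lies below it beyond the sweeping scale. -/
def cpl (ν A θ : ℝ) (m : ℕ) (k : Fin 3 → ℤ) : ℝ :=
  ν * A * θ ^ (max (∑ i, (k i).natAbs) m) / (1 + ((max (∑ i, (k i).natAbs) m : ℕ) : ℝ)) ^ 4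

/-- The tail modes of order `N` above level `m`. -/
def Tail (m N : ℕ) : Type :=
  {k : ↥(freqBall N : Finset (Fin 3 → ℤ)) // ((m : ℕ) : ℝ) ^ 2 < freqNormSq (k : Fin 3 → ℤ)}

instance instFintypeTail (m N : ℕ) : Fintype (Tail m N) := by
  unfold Tail; infer_instance

/-- An enumeration of the tail modes. -/
def tailEnum (m N : ℕ) : Fin (Fintype.card (Tail m N)) ≃ Tail m N :=
  (Fintype.equivFin (Tail m N)).symm

/-- The Galerkin vector field of order `N` driven by (the Fourier restriction of) `f`. -/
def fld (ν : ℝ) (f : UnitAddTorus (Fin 3) → EuclideanSpace ℝ (Fin 3)) (N : ℕ) (x : Coef N) : Coef N :=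
  galerkinRHS (freqBall N : Finset (Fin 3 → ℤ)) ν (fourierRestrict (freqBall N : Finset (Fin 3 → ℤ)) f) x

theorem continuous_fld (ν : ℝ) (f : UnitAddTorus (Fin 3) → EuclideanSpace ℝ (Fin 3)) (N : ℕ) :
    Continuous (fld ν f N) := by
  unfold fld
  exact (continuous_galerkinRHS ν).comp₂ continuous_const continuous_id

variable (ν : ℝ) (f : UnitAddTorus (Fin 3) → EuclideanSpace ℝ (Fin 3)) (A θ : ℝ) (m N : ℕ) {n : ℕ}
  (h : Fin n → Coef m → ℝ) (h' : Fin n → Coef m → (Coef m →L[ℝ] ℝ))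

/-- The lifted faces on the phase space of order `N`: LOW faces `h i ∘ P` (`Sum.inl`), TAIL faces the
per-mode Gevrey boxes `prof(k)² − ‖x k‖²`, `m² < |k|² ≤ N²` (`Sum.inr`). -/
def liftFace : Fin n ⊕ Fin (Fintype.card (Tail m N)) → Phase N → ℝ :=
  Sum.elim (fun i x => h i (relabel (freqBall N) (freqBall m) (x : Coef N)))
    (fun j x => prof A θ ((tailEnum m N j).1 : Fin 3 → ℤ) ^ 2 - ‖(x : Coef N) (tailEnum m N j).1‖ ^ 2)

/-- Their derivatives along the Galerkin phase flow of order `N`. -/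
def liftDeriv : Fin n ⊕ Fin (Fintype.card (Tail m N)) → Phase N → ℝ :=
  Sum.elim (fun i x => h' i (relabel (freqBall N) (freqBall m) (x : Coef N))
      (relabel (freqBall N) (freqBall m) (fld ν f N x)))
    (fun j x => -(2 * (inner ℂ ((x : Coef N) (tailEnum m N j).1) (fld ν f N x (tailEnum m N j).1)).re))

@[simp] theorem liftFace_inl (i : Fin n) (x : Phase N) :
    liftFace A θ m N h (Sum.inl i) x = h i (relabel (freqBall N) (freqBall m) (x : Coef N)) := rfl

@[simp] theorem liftFace_inr (j : Fin (Fintype.card (Tail m N))) (x : Phase N) :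
    liftFace A θ m N h (Sum.inr j) x =
      prof A θ ((tailEnum m N j).1 : Fin 3 → ℤ) ^ 2 - ‖(x : Coef N) (tailEnum m N j).1‖ ^ 2 := rfl

@[simp] theorem liftDeriv_inl (i : Fin n) (x : Phase N) :
    liftDeriv ν f m N h' (Sum.inl i) x = h' i (relabel (freqBall N) (freqBall m) (x : Coef N))
      (relabel (freqBall N) (freqBall m) (fld ν f N x)) := rfl

@[simp] theorem liftDeriv_inr (j : Fin (Fintype.card (Tail m N))) (x : Phase N) :
    liftDeriv ν f m N h' (Sum.inr j) x =
      -(2 * (inner ℂ ((x : Coef N) (tailEnum m N j).1) (fld ν f N x (tailEnum m N j).1)).re) := rfl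

/-! ### Regularity clauses -/

theorem continuous_liftFace (hh : ∀ i, Continuous (h i)) : ∀ i, Continuous (liftFace A θ m N h i) := by
  rintro (i | j)
  · exact (hh i).comp ((continuous_relabel _ _).comp continuous_subtype_val)
  · exact continuous_const.sub ((((continuous_apply _).comp continuous_subtype_val).norm).pow 2)

theorem continuous_liftDeriv (hh' : ∀ i, Continuous (h' i)) : ∀ i, Continuous (liftDeriv ν f m N h' i) := by
  have hF : Continuous (fld ν f N) := continuous_fld ν f N
  rintro (i | j)
  · exact ((hh' i).comp ((continuous_relabel _ _).comp continuous_subtype_val)).clm_apply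
      ((continuous_relabel _ _).comp (hF.comp continuous_subtype_val))
  · refine (continuous_const.mul (Complex.continuous_re.comp ?_)).neg
    exact ((continuous_apply _).comp continuous_subtype_val).inner
      ((continuous_apply _).comp (hF.comp continuous_subtype_val))

theorem hasDerivAt_liftFace (hν : 0 ≤ ν) (hf : Integrable f volume)
    (hfd : ∀ i y, HasFDerivAt (h i) (h' i y) y) (i : Fin n ⊕ Fin (Fintype.card (Tail m N)))
    (x : Phase N) (t : ℝ) (ht : 0 < t) :
    HasDerivAt
      (fun s => liftFace A θ m N h i (galerkinPhaseFlow ν (fourierRestrict (freqBall N : Finset (Fin 3 → ℤ)) f) s x))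
      (liftDeriv ν f m N h' i (galerkinPhaseFlow ν (fourierRestrict (freqBall N : Finset (Fin 3 → ℤ)) f) t x)) t := by
  have hS : ∀ k ∈ (freqBall N : Finset (Fin 3 → ℤ)), -k ∈ (freqBall N : Finset (Fin 3 → ℤ)) :=
    neg_mem_freqBall_of_mem
  have hg : IsRealCoeff (fourierRestrict (freqBall N : Finset (Fin 3 → ℤ)) f) := isRealCoeff_mFourierCoeff hf
  have hγ := (isGalerkinODESolution_galerkinCoeffFlow hν hS hg x.2).hasDerivAt ht
  rcases i with i | j
  · simp only [liftFace_inl, liftDeriv_inl, coe_galerkinPhaseFlow]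
    have h1 := (hasFDerivAt_relabel (freqBall N) (freqBall m) _).comp_hasDerivAt t hγ
    exact (hfd i _).comp_hasDerivAt t h1
  · simp only [liftFace_inr, liftDeriv_inr, coe_galerkinPhaseFlow]
    have h1 := (hasDerivAt_pi.1 hγ) (tailEnum m N j).1
    have h2 := h1.norm_sq
    have h3 := (hasDerivAt_const t (prof A θ ((tailEnum m N j).1 : Fin 3 → ℤ) ^ 2)).sub h2
    refine h3.congr_deriv ?_
    rw [zero_sub]
    rfl

/-! ### The mean-zero phase vectors: closed and forward invariant -/

theorem isClosed_meanZero (N : ℕ) :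
    IsClosed {x : Phase N | ∀ k : ↥(freqBall N : Finset (Fin 3 → ℤ)), (k : Fin 3 → ℤ) = 0 → (x : Coef N) k = 0} := by
  have : {x : Phase N | ∀ k : ↥(freqBall N : Finset (Fin 3 → ℤ)), (k : Fin 3 → ℤ) = 0 → (x : Coef N) k = 0} =
      ⋂ k : ↥(freqBall N : Finset (Fin 3 → ℤ)), {x : Phase N | (k : Fin 3 → ℤ) = 0 → (x : Coef N) k = 0} := by
    ext x; simp
  rw [this]
  refine isClosed_iInter fun k => ?_
  by_cases hk : (k : Fin 3 → ℤ) = 0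
  · simp only [hk, forall_const]
    exact isClosed_eq ((continuous_apply k).comp continuous_subtype_val) continuous_const
  · simp [hk]

theorem meanZero_invariant (hν : 0 ≤ ν) (hf : Integrable f volume) (h0 : HasZeroMean f) :
    ∀ x ∈ {x : Phase N | ∀ k : ↥(freqBall N : Finset (Fin 3 → ℤ)), (k : Fin 3 → ℤ) = 0 → (x : Coef N) k = 0},
      ∀ t : ℝ, 0 ≤ t → galerkinPhaseFlow ν (fourierRestrict (freqBall N : Finset (Fin 3 → ℤ)) f) t x ∈
        {x : Phase N | ∀ k : ↥(freqBall N : Finset (Fin 3 → ℤ)), (k : Fin 3 → ℤ) = 0 → (x : Coef N) k = 0} :=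
  fun x hx t ht => Theorems.UniformGalerkinTrap.Sketch.stub_meanZeroInvariant ν N f x t hν hf h0 hx ht

end Lift

/-! ## §5 The block clauses at level `N` from level-`m` data and the tail estimates -/

section Clauses

variable {ν : ℝ} {f : UnitAddTorus (Fin 3) → EuclideanSpace ℝ (Fin 3)} {A θ δ : ℝ} {m N : ℕ} {n : ℕ}
  {h : Fin n → Coef m → ℝ} {h' : Fin n → Coef m → (Coef m →L[ℝ] ℝ)}

/-- The mean-zero phase vectors of order `n` (the closed forward-invariant set `M` of the block). -/
abbrev meanZero (n : ℕ) : Set (Phase n) :=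
  {x | ∀ k : ↥(freqBall n : Finset (Fin 3 → ℤ)), (k : Fin 3 → ℤ) = 0 → (x : Coef n) k = 0}

theorem symm_freqBall (n : ℕ) : ∀ k ∈ (freqBall n : Finset (Fin 3 → ℤ)), -k ∈ (freqBall n : Finset (Fin 3 → ℤ)) :=
  neg_mem_freqBall_of_mem

/-- Restriction `P : Phase N → Phase m`. -/
abbrev restrP (m N : ℕ) : Phase N → Phase m := relabelPhase (symm_freqBall N) (freqBall m)

/-- Extension by zero `ι : Phase m → Phase N`. -/
abbrev extI (m N : ℕ) : Phase m → Phase N := relabelPhase (symm_freqBall m) (freqBall N)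

theorem restrP_extI (hmN : m ≤ N) (y : Phase m) : restrP m N (extI m N y) = y :=
  Subtype.ext (relabel_relabel_of_subset (freqBall_mono hmN) _)

/-- **(B1) Restriction maps the lifted block into the low block.** -/
theorem restrP_mem_low (hmN : m ≤ N) {x : Phase N}
    (hx : x ∈ faceSet (liftFace A θ m N h) ∩ meanZero N) :
    (∀ i, 0 ≤ h i (restrP m N x : Phase m)) ∧
      ∀ k : ↥(freqBall m : Finset (Fin 3 → ℤ)), (k : Fin 3 → ℤ) = 0 → ((restrP m N x : Phase m) : Coef m) k = 0 := by
  refine ⟨fun i => ?_, fun l hl => ?_⟩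
  · have := (mem_faceSet_iff.1 hx.1) (Sum.inl i)
    simpa using this
  · have hlN : (l : Fin 3 → ℤ) ∈ (freqBall N : Finset (Fin 3 → ℤ)) := freqBall_mono hmN l.2
    show relabel (freqBall N) (freqBall m) (x : Coef N) l = 0
    rw [relabel_apply_of_mem _ hlN]
    exact hx.2 ⟨l, hlN⟩ hl

/-- **(B2) The lifted block lies in the profile box** (low modes: the level-`m` enclosure; tail modes:
the tail faces). -/
theorem box_of_mem (hmN : m ≤ N) (hA : 0 < A) (hθ : 0 < θ)
    (hBox : ∀ y : Phase m, (∀ i, 0 ≤ h i y) →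
      (∀ k : ↥(freqBall m : Finset (Fin 3 → ℤ)), (k : Fin 3 → ℤ) = 0 → (y : Coef m) k = 0) →
      ∀ k : ↥(freqBall m : Finset (Fin 3 → ℤ)), ‖(y : Coef m) k‖ ≤ prof A θ k)
    {x : Phase N} (hx : x ∈ faceSet (liftFace A θ m N h) ∩ meanZero N) :
    ∀ k : ↥(freqBall N : Finset (Fin 3 → ℤ)), ‖(x : Coef N) k‖ ≤ prof A θ k := by
  intro k
  by_cases hk : ((m : ℕ) : ℝ) ^ 2 < freqNormSq (k : Fin 3 → ℤ)
  · -- a tail mode: read the tail face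
    set j := (tailEnum m N).symm ⟨k, hk⟩ with hj
    have hface := (mem_faceSet_iff.1 hx.1) (Sum.inr j)
    rw [liftFace_inr, hj, Equiv.apply_symm_apply] at hface
    have hsq : ‖(x : Coef N) k‖ ^ 2 ≤ prof A θ k ^ 2 := by
      simpa using sub_nonneg.1 hface
    exact (pow_le_pow_iff_left₀ (norm_nonneg _) (prof_pos hA hθ _).le two_ne_zero).1 hsq
  · -- a low mode: read the level-`m` enclosure at `P x`
    have hkm : (k : Fin 3 → ℤ) ∈ (freqBall m : Finset (Fin 3 → ℤ)) := mem_freqBall.2 (not_lt.1 hk)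
    obtain ⟨h1, h2⟩ := restrP_mem_low (A := A) (θ := θ) (h := h) hmN hx
    have := hBox _ h1 h2 ⟨k, hkm⟩
    rw [coe_relabelPhase,
      relabel_apply_of_mem (k := (⟨(k : Fin 3 → ℤ), hkm⟩ : ↥(freqBall m : Finset (Fin 3 → ℤ)))) (x : Coef N) k.2]
      at this
    exact this

/-- **(B4) Robust sign transfer at level `m`.** -/
theorem neg_iff_neg_of_robust
    (hRob : ∀ y : Phase m, (∀ i, 0 ≤ h i y) →
      (∀ k : ↥(freqBall m : Finset (Fin 3 → ℤ)), (k : Fin 3 → ℤ) = 0 → (y : Coef m) k = 0) →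
      ∀ i, h i y = 0 → ∀ w : Coef m, (∀ k : ↥(freqBall m : Finset (Fin 3 → ℤ)), ‖w k‖ ≤ cpl ν A θ m k) →
        h' i y (fld ν f m y + w) ≠ 0)
    {y : Phase m} (hy1 : ∀ i, 0 ≤ h i y)
    (hy2 : ∀ k : ↥(freqBall m : Finset (Fin 3 → ℤ)), (k : Fin 3 → ℤ) = 0 → (y : Coef m) k = 0)
    {i : Fin n} (hi : h i y = 0) {w : Coef m}
    (hw : ∀ k : ↥(freqBall m : Finset (Fin 3 → ℤ)), ‖w k‖ ≤ cpl ν A θ m k) :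
    (h' i y (fld ν f m y + w) < 0 ↔ h' i y (fld ν f m y) < 0) := by
  have hside : ∀ s ∈ Set.Icc (0 : ℝ) 1, h' i y (fld ν f m y) + s * h' i y w ≠ 0 := by
    intro s hs
    have hsw : ∀ k : ↥(freqBall m : Finset (Fin 3 → ℤ)), ‖(s • w) k‖ ≤ cpl ν A θ m k := by
      intro k
      rw [Pi.smul_apply, norm_smul, Real.norm_eq_abs, abs_of_nonneg hs.1]
      calc s * ‖w k‖ ≤ 1 * ‖w k‖ := by gcongr; exact hs.2
        _ = ‖w k‖ := one_mul _
        _ ≤ cpl ν A θ m k := hw k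
    have := hRob y hy1 hy2 i hi (s • w) hsw
    rwa [map_add, map_smul, smul_eq_mul] at this
  have key := neg_iff_neg_of_forall_add_mul_ne_zero hside
  have e : h' i y (fld ν f m y + w) = h' i y (fld ν f m y) + h' i y w := map_add _ _ _
  rw [e]
  exact key

/-- **(B5/B6) Tail faces are strict entrance faces on the lifted block.** -/
theorem liftDeriv_inr_pos (hmN : m ≤ N) (hA : 0 < A) (hθ : 0 < θ)
    (hBox : ∀ y : Phase m, (∀ i, 0 ≤ h i y) →
      (∀ k : ↥(freqBall m : Finset (Fin 3 → ℤ)), (k : Fin 3 → ℤ) = 0 → (y : Coef m) k = 0) →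
      ∀ k : ↥(freqBall m : Finset (Fin 3 → ℤ)), ‖(y : Coef m) k‖ ≤ prof A θ k)
    (hEnt : ∀ x : Coef N, (∀ k, ‖x k‖ ≤ prof A θ k) →
      ∀ k : ↥(freqBall N : Finset (Fin 3 → ℤ)), ((m : ℕ) : ℝ) ^ 2 < freqNormSq (k : Fin 3 → ℤ) →
        fourierRestrict (freqBall N : Finset (Fin 3 → ℤ)) f k = 0 → ‖x k‖ = prof A θ k →
        (inner ℂ (x k) (fld ν f N x k)).re < 0)
    (hForce : ∀ k : Fin 3 → ℤ, ((m : ℕ) : ℝ) ^ 2 < freqNormSq k →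
      UnitAddTorus.mFourierCoeff (EuclideanSpace.complexify ∘ f) k = 0)
    {x : Phase N} (hx : x ∈ faceSet (liftFace A θ m N h) ∩ meanZero N)
    (j : Fin (Fintype.card (Tail m N))) (hj : liftFace A θ m N h (Sum.inr j) x = 0) :
    0 < liftDeriv ν f m N h' (Sum.inr j) x := by
  set k := (tailEnum m N j).1 with hk
  have hkt : ((m : ℕ) : ℝ) ^ 2 < freqNormSq (k : Fin 3 → ℤ) := (tailEnum m N j).2
  rw [liftFace_inr] at hj
  have hnorm : ‖(x : Coef N) k‖ = prof A θ k := by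
    have hsq : ‖(x : Coef N) k‖ ^ 2 = prof A θ k ^ 2 := by rw [hk]; linarith
    exact (pow_left_inj₀ (norm_nonneg _) (prof_pos hA hθ _).le two_ne_zero).1 hsq
  have hg : fourierRestrict (freqBall N : Finset (Fin 3 → ℤ)) f k = 0 := hForce _ hkt
  have := hEnt (x : Coef N) (box_of_mem hmN hA hθ hBox hx) k hkt hg hnorm
  rw [liftDeriv_inr, ← hk]
  linarith

/-- **(B5) Low faces are transversal on the lifted block** (robustness against the tail coupling). -/
theorem liftDeriv_inl_ne_zero (hmN : m ≤ N) (hA : 0 < A) (hθ : 0 < θ)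
    (hBox : ∀ y : Phase m, (∀ i, 0 ≤ h i y) →
      (∀ k : ↥(freqBall m : Finset (Fin 3 → ℤ)), (k : Fin 3 → ℤ) = 0 → (y : Coef m) k = 0) →
      ∀ k : ↥(freqBall m : Finset (Fin 3 → ℤ)), ‖(y : Coef m) k‖ ≤ prof A θ k)
    (hRob : ∀ y : Phase m, (∀ i, 0 ≤ h i y) →
      (∀ k : ↥(freqBall m : Finset (Fin 3 → ℤ)), (k : Fin 3 → ℤ) = 0 → (y : Coef m) k = 0) →
      ∀ i, h i y = 0 → ∀ w : Coef m, (∀ k : ↥(freqBall m : Finset (Fin 3 → ℤ)), ‖w k‖ ≤ cpl ν A θ m k) →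
        h' i y (fld ν f m y + w) ≠ 0)
    (hCpl : ∀ x : Coef N, (∀ k, ‖x k‖ ≤ prof A θ k) →
      ∀ k : ↥(freqBall m : Finset (Fin 3 → ℤ)),
        ‖relabel (freqBall N) (freqBall m) (fld ν f N x) k - fld ν f m (relabel (freqBall N) (freqBall m) x) k‖ ≤
          cpl ν A θ m k)
    {x : Phase N} (hx : x ∈ faceSet (liftFace A θ m N h) ∩ meanZero N)
    (i : Fin n) (hi : liftFace A θ m N h (Sum.inl i) x = 0) :
    liftDeriv ν f m N h' (Sum.inl i) x ≠ 0 := by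
  obtain ⟨h1, h2⟩ := restrP_mem_low (A := A) (θ := θ) (h := h) hmN hx
  rw [liftFace_inl] at hi
  have hw := hCpl (x : Coef N) (box_of_mem hmN hA hθ hBox hx)
  have := hRob (restrP m N x) h1 h2 i hi _ hw
  rwa [liftDeriv_inl, ← add_sub_cancel (fld ν f m (relabel (freqBall N) (freqBall m) (x : Coef N)))
    (relabel (freqBall N) (freqBall m) (fld ν f N x))]

/-- **(B7) Non-retraction lifts from level `m` to level `N`.** -/
theorem not_retract_lift (hmN : m ≤ N) (hA : 0 < A) (hθ : 0 < θ)
    (hBox : ∀ y : Phase m, (∀ i, 0 ≤ h i y) →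
      (∀ k : ↥(freqBall m : Finset (Fin 3 → ℤ)), (k : Fin 3 → ℤ) = 0 → (y : Coef m) k = 0) →
      ∀ k : ↥(freqBall m : Finset (Fin 3 → ℤ)), ‖(y : Coef m) k‖ ≤ prof A θ k)
    (hRob : ∀ y : Phase m, (∀ i, 0 ≤ h i y) →
      (∀ k : ↥(freqBall m : Finset (Fin 3 → ℤ)), (k : Fin 3 → ℤ) = 0 → (y : Coef m) k = 0) →
      ∀ i, h i y = 0 → ∀ w : Coef m, (∀ k : ↥(freqBall m : Finset (Fin 3 → ℤ)), ‖w k‖ ≤ cpl ν A θ m k) →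
        h' i y (fld ν f m y + w) ≠ 0)
    (hCpl : ∀ x : Coef N, (∀ k, ‖x k‖ ≤ prof A θ k) →
      ∀ k : ↥(freqBall m : Finset (Fin 3 → ℤ)),
        ‖relabel (freqBall N) (freqBall m) (fld ν f N x) k - fld ν f m (relabel (freqBall N) (freqBall m) x) k‖ ≤
          cpl ν A θ m k)
    (hnr : ¬ ∃ r : Phase m → Phase m,
      ContinuousOn r {y | (∀ i, 0 ≤ h i y) ∧
        ∀ k : ↥(freqBall m : Finset (Fin 3 → ℤ)), (k : Fin 3 → ℤ) = 0 → (y : Coef m) k = 0} ∧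
      MapsTo r {y | (∀ i, 0 ≤ h i y) ∧
        ∀ k : ↥(freqBall m : Finset (Fin 3 → ℤ)), (k : Fin 3 → ℤ) = 0 → (y : Coef m) k = 0}
        {y | ((∀ i, 0 ≤ h i y) ∧
          ∀ k : ↥(freqBall m : Finset (Fin 3 → ℤ)), (k : Fin 3 → ℤ) = 0 → (y : Coef m) k = 0) ∧
          ∃ i, h i y = 0 ∧ h' i y (fld ν f m y) < 0} ∧
      ∀ y ∈ {y : Phase m | ((∀ i, 0 ≤ h i y) ∧
          ∀ k : ↥(freqBall m : Finset (Fin 3 → ℤ)), (k : Fin 3 → ℤ) = 0 → (y : Coef m) k = 0) ∧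
          ∃ i, h i y = 0 ∧ h' i y (fld ν f m y) < 0}, r y = y) :
    ¬ ∃ r : Phase N → Phase N,
      ContinuousOn r (faceSet (liftFace A θ m N h) ∩ meanZero N) ∧
      MapsTo r (faceSet (liftFace A θ m N h) ∩ meanZero N)
        {x | x ∈ faceSet (liftFace A θ m N h) ∩ meanZero N ∧
          ∃ i : Fin n, liftFace A θ m N h (Sum.inl i) x = 0 ∧ liftDeriv ν f m N h' (Sum.inl i) x < 0} ∧
      ∀ x ∈ {x | x ∈ faceSet (liftFace A θ m N h) ∩ meanZero N ∧
          ∃ i : Fin n, liftFace A θ m N h (Sum.inl i) x = 0 ∧ liftDeriv ν f m N h' (Sum.inl i) x < 0}, r x = x := by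
  refine not_retract_of_section (extI m N) (restrP m N) (continuous_relabelPhase _ _)
    (continuous_relabelPhase _ _) (restrP_extI hmN) ?_ ?_ ?_ hnr
  · -- ι maps the low block into the lifted block
    rintro y ⟨hy1, hy2⟩
    refine ⟨mem_faceSet_iff.2 ?_, fun k hk => ?_⟩
    · rintro (i | j)
      · rw [liftFace_inl, coe_relabelPhase, relabel_relabel_of_subset (freqBall_mono hmN)]
        exact hy1 i
      · rw [liftFace_inr, coe_relabelPhase,
          relabel_apply_of_not_mem _ (not_mem_freqBall.2 (tailEnum m N j).2), norm_zero,
          zero_pow two_ne_zero, sub_zero]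
        positivity
    · rw [coe_relabelPhase, relabel_apply, hk, coeffExt_of_mem _ (zero_mem_freqBall m)]
      exact hy2 ⟨0, zero_mem_freqBall m⟩ rfl
  · -- ι maps the low exit set into the lifted exit set
    rintro y ⟨⟨hy1, hy2⟩, i, hi, hneg⟩
    have hιB : extI m N y ∈ faceSet (liftFace A θ m N h) ∩ meanZero N := by
      refine ⟨mem_faceSet_iff.2 ?_, fun k hk => ?_⟩
      · rintro (i | j)
        · rw [liftFace_inl, coe_relabelPhase, relabel_relabel_of_subset (freqBall_mono hmN)]
          exact hy1 i
        · rw [liftFace_inr, coe_relabelPhase,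
            relabel_apply_of_not_mem _ (not_mem_freqBall.2 (tailEnum m N j).2), norm_zero,
            zero_pow two_ne_zero, sub_zero]
          positivity
      · rw [coe_relabelPhase, relabel_apply, hk, coeffExt_of_mem _ (zero_mem_freqBall m)]
        exact hy2 ⟨0, zero_mem_freqBall m⟩ rfl
    refine ⟨hιB, i, ?_, ?_⟩
    · rw [liftFace_inl, coe_relabelPhase, relabel_relabel_of_subset (freqBall_mono hmN)]
      exact hi
    · have hw := hCpl _ (box_of_mem hmN hA hθ hBox hιB)
      simp only [coe_relabelPhase, relabel_relabel_of_subset (freqBall_mono hmN)] at hw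
      have key := (neg_iff_neg_of_robust hRob hy1 hy2 hi (fun k => by simpa using hw k)).2 hneg
      rwa [liftDeriv_inl, coe_relabelPhase, relabel_relabel_of_subset (freqBall_mono hmN),
        ← add_sub_cancel (fld ν f m (y : Coef m)) (relabel (freqBall N) (freqBall m) (fld ν f N _))]
  · -- P maps the lifted exit set into the low exit set
    rintro x ⟨hx, i, hi, hneg⟩
    obtain ⟨h1, h2⟩ := restrP_mem_low (A := A) (θ := θ) (h := h) hmN hx
    refine ⟨⟨h1, h2⟩, i, ?_, ?_⟩
    · rw [liftFace_inl] at hi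
      exact hi
    · rw [liftFace_inl] at hi
      have hw := hCpl (x : Coef N) (box_of_mem hmN hA hθ hBox hx)
      rw [liftDeriv_inl, ← add_sub_cancel (fld ν f m (relabel (freqBall N) (freqBall m) (x : Coef N)))
        (relabel (freqBall N) (freqBall m) (fld ν f N x))] at hneg
      exact (neg_iff_neg_of_robust hRob h1 h2 hi hw).1 hneg

/-- **(B8) The lifted block lies in the coefficient window** (low sums from the level-`m` enclosure,
tail sums from the tail estimates, the force sees no tail mode). -/
theorem window_of_mem (hmN : m ≤ N) {E ε₀ : ℝ} {G : ℝ≥0}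
    (hEncl : ∀ y : Phase m, (∀ i, 0 ≤ h i y) →
      (∀ k : ↥(freqBall m : Finset (Fin 3 → ℤ)), (k : Fin 3 → ℤ) = 0 → (y : Coef m) k = 0) →
      2⁻¹ * ∑ k, ‖(y : Coef m) k‖ ^ 2 + δ ≤ E ∧
      ε₀ ≤ ∑ k, (inner ℂ (fourierRestrict (freqBall m : Finset (Fin 3 → ℤ)) f k) ((y : Coef m) k)).re ∧
      4 * Real.pi ^ 2 * ∑ k, freqNormSq ((k : ↥(freqBall m : Finset (Fin 3 → ℤ))) : Fin 3 → ℤ) *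
        ‖(y : Coef m) k‖ ^ 2 + δ ≤ (G : ℝ))
    (hForce : ∀ k : Fin 3 → ℤ, ((m : ℕ) : ℝ) ^ 2 < freqNormSq k →
      UnitAddTorus.mFourierCoeff (EuclideanSpace.complexify ∘ f) k = 0)
    {x : Phase N} (hx : x ∈ faceSet (liftFace A θ m N h) ∩ meanZero N)
    (hTailE : 2⁻¹ * ∑ k : ↥(freqBall N : Finset (Fin 3 → ℤ)), ‖(x : Coef N) k‖ ^ 2 ≤
      2⁻¹ * ∑ l : ↥(freqBall m : Finset (Fin 3 → ℤ)), ‖coeffExt (freqBall N) (x : Coef N) (l : Fin 3 → ℤ)‖ ^ 2 + δ)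
    (hTailZ : 4 * Real.pi ^ 2 * ∑ k : ↥(freqBall N : Finset (Fin 3 → ℤ)), freqNormSq (k : Fin 3 → ℤ) * ‖(x : Coef N) k‖ ^ 2 ≤
      4 * Real.pi ^ 2 * ∑ l : ↥(freqBall m : Finset (Fin 3 → ℤ)),
        freqNormSq (l : Fin 3 → ℤ) * ‖coeffExt (freqBall N) (x : Coef N) (l : Fin 3 → ℤ)‖ ^ 2 + δ) :
    2⁻¹ * ∑ k, ‖(x : Coef N) k‖ ^ 2 ≤ E ∧
      ε₀ ≤ ∑ k, (inner ℂ (fourierRestrict (freqBall N : Finset (Fin 3 → ℤ)) f k) ((x : Coef N) k)).re ∧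
      4 * Real.pi ^ 2 * ∑ k, freqNormSq ((k : ↥(freqBall N : Finset (Fin 3 → ℤ))) : Fin 3 → ℤ) *
        ‖(x : Coef N) k‖ ^ 2 ≤ (G : ℝ) := by
  obtain ⟨h1, h2⟩ := restrP_mem_low (A := A) (θ := θ) (h := h) hmN hx
  obtain ⟨hE, hW, hZ⟩ := hEncl _ h1 h2
  -- the low sums are the sums of the restriction `P x`
  have eE : ∑ l : ↥(freqBall m : Finset (Fin 3 → ℤ)), ‖coeffExt (freqBall N) (x : Coef N) (l : Fin 3 → ℤ)‖ ^ 2 =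
      ∑ l : ↥(freqBall m : Finset (Fin 3 → ℤ)), ‖((restrP m N x : Phase m) : Coef m) l‖ ^ 2 := rfl
  have eZ : ∑ l : ↥(freqBall m : Finset (Fin 3 → ℤ)),
        freqNormSq (l : Fin 3 → ℤ) * ‖coeffExt (freqBall N) (x : Coef N) (l : Fin 3 → ℤ)‖ ^ 2 =
      ∑ l : ↥(freqBall m : Finset (Fin 3 → ℤ)), freqNormSq ((l : ↥(freqBall m : Finset (Fin 3 → ℤ))) : Fin 3 → ℤ) *
        ‖((restrP m N x : Phase m) : Coef m) l‖ ^ 2 := rfl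
  -- the work splits into the low work and a vanishing tail
  have eW : ∑ k : ↥(freqBall N : Finset (Fin 3 → ℤ)),
      (inner ℂ (fourierRestrict (freqBall N : Finset (Fin 3 → ℤ)) f k) ((x : Coef N) k)).re =
      ∑ l : ↥(freqBall m : Finset (Fin 3 → ℤ)),
        (inner ℂ (fourierRestrict (freqBall m : Finset (Fin 3 → ℤ)) f l) (((restrP m N x : Phase m) : Coef m) l)).re +
      ∑ k : ↥(freqBall N : Finset (Fin 3 → ℤ)),
        (if ((m : ℕ) : ℝ) ^ 2 < freqNormSq (k : Fin 3 → ℤ) then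
          (inner ℂ (fourierRestrict (freqBall N : Finset (Fin 3 → ℤ)) f k) ((x : Coef N) k)).re else 0) := by
    have := sum_freqBall_split hmN
      (fun k => (inner ℂ (UnitAddTorus.mFourierCoeff (EuclideanSpace.complexify ∘ f) k)
        (coeffExt (freqBall N) (x : Coef N) k)).re)
    simpa only [coeffExt_coe, coe_relabelPhase, relabel_apply, fourierRestrict_apply] using this
  have hWt : ∑ k : ↥(freqBall N : Finset (Fin 3 → ℤ)),
      (if ((m : ℕ) : ℝ) ^ 2 < freqNormSq (k : Fin 3 → ℤ) then
        (inner ℂ (fourierRestrict (freqBall N : Finset (Fin 3 → ℤ)) f k) ((x : Coef N) k)).re else 0) = 0 := by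
    refine Finset.sum_eq_zero fun k _ => ?_
    split_ifs with hk
    · rw [fourierRestrict_apply, hForce _ hk, inner_zero_left, Complex.zero_re]
    · rfl
  refine ⟨?_, ?_, ?_⟩
  · rw [eE] at hTailE; linarith
  · rw [eW, hWt, add_zero]; exact hW
  · rw [eZ] at hTailZ; linarith

/-- **The degenerate (faceless) instance is excluded.** For any face data on the order-`m` coefficient space whose
block `{∀ i, 0 ≤ h i} ∩ {mean mode = 0}` satisfies the work-floor enclosure with `ε₀ > 0`, the number of faces is
positive: with no faces the block is the whole mean-zero subspace, which contains `0`, where the work vanishes.  So a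
bare forward-invariant window set — the content of `UniformGalerkinTrap` via p105977 — is not an instance of
`RobustLoudLowBlocks`. [folklore] -/
theorem faces_pos {f : UnitAddTorus (Fin 3) → EuclideanSpace ℝ (Fin 3)} {ε₀ : ℝ} {m n : ℕ}
    (h : Fin n → Coef m → ℝ) (hε₀ : 0 < ε₀)
    (hW : ∀ y : Phase m, (∀ i, 0 ≤ h i y) →
      (∀ k : ↥(freqBall m : Finset (Fin 3 → ℤ)), (k : Fin 3 → ℤ) = 0 → (y : Coef m) k = 0) →
      ε₀ ≤ ∑ k, (inner ℂ (fourierRestrict (freqBall m : Finset (Fin 3 → ℤ)) f k) ((y : Coef m) k)).re) :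
    0 < n := by
  rcases Nat.eq_zero_or_pos n with hn | hn
  · subst hn
    have h1 : ∀ i : Fin 0, 0 ≤ h i ((0 : Phase m) : Coef m) := fun i => i.elim0
    have h2 : ∀ k : ↥(freqBall m : Finset (Fin 3 → ℤ)), (k : Fin 3 → ℤ) = 0 →
        ((0 : Phase m) : Coef m) k = 0 := fun k _ => rfl
    have := hW 0 h1 h2
    simp at this
    exact absurd this (not_le.2 hε₀)
  · exact hn

end Clauses

/-! ## §6 The assembly: `RobustLoudLowBlocks → UniformTailEstimates → UniformGalerkinTrap` -/

/-- **Composition of line `TailLift`** — the crux BY NAME from the two registered stubs (`stub_robustLoudLowBlocks`, open;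
`stub_uniformTailEstimates`, proved in PART I), by the tail-lift assembly.  Per viscosity: take the profile/margin data `(A, θ, δ, G)` of the low-block
piece, the sweeping scale `M` of the tail piece for these data, a robust loud low block at a level
`m ≥ M`; then at EVERY `N ≥ m` the product of the low block with the Gevrey tail boxes is an
entrance-faced transversal polyfacial block relative to the mean-zero phase vectors, inside the window,
not retracting onto its low exit set (§5), and `TailLift.uniformGalerkinTrap_of_entranceFacedBlocks`
(p119366) concludes. -/
theorem UniformGalerkinTrap_of :
    Summit.AnomalousDissipation.AnomalousDissipation.Theses.WazewskiBlock.UniformGalerkinTrap := by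
  obtain ⟨mf, f, hf, E, ε₀, ν₀, hε₀, hν₀, hP1⟩ := stub_robustLoudLowBlocks
  have hP2 := stub_uniformTailEstimates
  refine Theorems.UniformGalerkinTrap.TailLift.uniformGalerkinTrap_of_entranceFacedBlocks
    ⟨mf, f, hf, E, ε₀, ν₀, hε₀, hν₀, fun ν hν hνle => ?_⟩
  obtain ⟨A, θ, δ, G, hA, hθ, hθ1, hδ, hblk⟩ := hP1 ν hν hνle
  obtain ⟨M, hM⟩ := hP2 ν A θ δ hν hA hθ hθ1 hδ
  obtain ⟨m, hMm, hmfm, n, h, h', hfd, hh', hrob, hnr, hencl⟩ := hblk M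
  refine ⟨G, m, fun N hmN => ?_⟩
  have hT := hM m N hMm hmN
  have hfi : Integrable f volume := hf.1.1.continuous.integrable_unitAddTorus
  -- the force sees no mode above level `m ≥ mf`
  have hForce : ∀ k : Fin 3 → ℤ, ((m : ℕ) : ℝ) ^ 2 < freqNormSq k →
      UnitAddTorus.mFourierCoeff (EuclideanSpace.complexify ∘ f) k = 0 := by
    intro k hk
    refine hf.1.2.2 k (lt_of_le_of_lt ?_ hk)
    exact_mod_cast Nat.pow_le_pow_left hmfm 2
  -- the level-`m` data in the shape of §5
  have hBox : ∀ y : Phase m, (∀ i, 0 ≤ h i y) →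
      (∀ k : ↥(freqBall m : Finset (Fin 3 → ℤ)), (k : Fin 3 → ℤ) = 0 → (y : Coef m) k = 0) →
      ∀ k : ↥(freqBall m : Finset (Fin 3 → ℤ)), ‖(y : Coef m) k‖ ≤ prof A θ k :=
    fun y h1 h2 => (hencl y h1 h2).1
  have hEncl : ∀ y : Phase m, (∀ i, 0 ≤ h i y) →
      (∀ k : ↥(freqBall m : Finset (Fin 3 → ℤ)), (k : Fin 3 → ℤ) = 0 → (y : Coef m) k = 0) →
      2⁻¹ * ∑ k, ‖(y : Coef m) k‖ ^ 2 + δ ≤ E ∧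
      ε₀ ≤ ∑ k, (inner ℂ (fourierRestrict (freqBall m : Finset (Fin 3 → ℤ)) f k) ((y : Coef m) k)).re ∧
      4 * Real.pi ^ 2 * ∑ k, freqNormSq ((k : ↥(freqBall m : Finset (Fin 3 → ℤ))) : Fin 3 → ℤ) *
        ‖(y : Coef m) k‖ ^ 2 + δ ≤ (G : ℝ) :=
    fun y h1 h2 => (hencl y h1 h2).2
  have hRob : ∀ y : Phase m, (∀ i, 0 ≤ h i y) →
      (∀ k : ↥(freqBall m : Finset (Fin 3 → ℤ)), (k : Fin 3 → ℤ) = 0 → (y : Coef m) k = 0) →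
      ∀ i, h i y = 0 → ∀ w : Coef m, (∀ k : ↥(freqBall m : Finset (Fin 3 → ℤ)), ‖w k‖ ≤ cpl ν A θ m k) →
        h' i y (fld ν f m y + w) ≠ 0 :=
    hrob
  -- the tail estimates in the shape of §5
  have hEnt : ∀ x : Coef N, (∀ k, ‖x k‖ ≤ prof A θ k) →
      ∀ k : ↥(freqBall N : Finset (Fin 3 → ℤ)), ((m : ℕ) : ℝ) ^ 2 < freqNormSq (k : Fin 3 → ℤ) →
        fourierRestrict (freqBall N : Finset (Fin 3 → ℤ)) f k = 0 → ‖x k‖ = prof A θ k →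
        (inner ℂ (x k) (fld ν f N x k)).re < 0 :=
    fun x hx k hk hg hn => (hT x hx).1 _ k hk hg hn
  have hCpl : ∀ x : Coef N, (∀ k, ‖x k‖ ≤ prof A θ k) →
      ∀ k : ↥(freqBall m : Finset (Fin 3 → ℤ)),
        ‖relabel (freqBall N) (freqBall m) (fld ν f N x) k - fld ν f m (relabel (freqBall N) (freqBall m) x) k‖ ≤
          cpl ν A θ m k :=
    fun x hx k => (hT x hx).2.1 f k
  refine ⟨n, Fintype.card (Tail m N), liftFace A θ m N h, liftDeriv ν f m N h', meanZero N,
    continuous_liftFace A θ m N h (fun i => continuous_iff_continuousAt.2 fun y => (hfd i y).continuousAt),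
    continuous_liftDeriv ν f m N h' hh',
    fun i x t ht => hasDerivAt_liftFace ν f A θ m N h h' hν.le hfi hfd i x t ht,
    isClosed_meanZero N, meanZero_invariant ν f N hν.le hfi hf.2, ?_, ?_, ?_, ?_⟩
  · -- transversality of the active faces
    rintro x hx (i | j) hi
    · exact liftDeriv_inl_ne_zero hmN hA hθ hBox hRob hCpl hx i hi
    · exact (liftDeriv_inr_pos hmN hA hθ hBox hEnt hForce hx j hi).ne'
  · -- tail faces are strict entrance faces
    exact fun x hx j hj => liftDeriv_inr_pos hmN hA hθ hBox hEnt hForce hx j hj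
  · -- no retraction onto the low exit set
    exact not_retract_lift hmN hA hθ hBox hRob hCpl hnr
  · -- the block lies in the window
    intro x hx
    have hb := box_of_mem hmN hA hθ hBox hx
    exact window_of_mem hmN hEncl hForce hx (hT (x : Coef N) hb).2.2.1 (hT (x : Coef N) hb).2.2.2

end Summit.AnomalousDissipation.AnomalousDissipation.Cruxes.UniformGalerkinTrap.TailLift

end
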